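import Literature.Geometry.Lorentzian.KerrFarRegionCutoff
import Literature.Geometry.Lorentzian.KerrPointwiseDecay
import HarnessLib

/-!
# The far-region `∂_{t*}`-energy inequality between two hyperboloidal leaves of subextremal Kerr
# (Moschidis, Lemma 4.5, for the exact Killing field of Kerr): the far flux through `Σ̃_t(h♯_{R₁})`
# is bounded by the flux through `Σ̃_s(h♯_{R₁})` and a local error on the cut-off collar

(statement group **gr.S24**; first far-region estimate of the programme proving the named fact
`Kerr.dafermosRodnianski_pHierarchy_scri` of `KerrDecayHierarchy.lean`; namespace
`Literature.Geometry.Lorentzian.Kerr`)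

Moschidis (arXiv:1509.08489 = Ann. PDE 2 (2016)), Lemma 4.5, proves for the hyperboloids
`{t̄ = τ}` of a general asymptotically flat far region `𝓝_af` the boundedness of the (weighted)
`J^T`-energy: `∫_{𝓢_{τ₂} ∩ {t ≤ T*}} χ J^T_μ n̄^μ + ∫_{{t = T*} ∩ 𝓡(τ₁,τ₂)} J^T_μ n^μ ≤ C { ∫_{𝓢_{τ₁} ∩ {t ≤ T*}} χ J^T n̄
+ ∫_{𝓡(τ₁,τ₂) ∩ {t ≤ T*}} (errors from ∇T and from ∂χ) }`, the error terms being supported where the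
cut-off `χ = χ_R` to the far region is not constant, plus terms `O(r^{-1-a})|∂φ|²` from the failure
of `T` to be Killing. On the Kerr exterior `T = ∂_{t*}` **is** Killing and the coefficients of the
Kerr–Schild chart are stationary (`K^T = 0`, `Kerr.multiplierBulk_timeTranslation_eq_zero`), so only
the cut-off error survives. This file proves the resulting inequality for the leaves
`Σ̃_τ(h♯_{R₁}) = {t*_KS = τ + h♯_{R₁}(y)}` of `KerrHyperboloidalFlux.lean` and an admissible wave `ψ`
(`IsAdmissibleKerrWave`), in the currency of `Kerr.dafermosRodnianski_pHierarchy_scri`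
(`Kerr.leafFlux`, `Kerr.farLeafFlux`, `Kerr.localLeafFlux`, all `V`-fluxes, `V = −g♯dt*`):

* `Kerr.farLeafFlux_scriHeight_le_leafFlux` (**proved**; corollaries `Kerr.farLeafFlux_scriHeight_le`
  between two leaves and `Kerr.farLeafFlux_scriHeight_le_leafFlux_slice` from a slice): for
  `|a| < M`, `R₁ > 2M`, a cut-off radius `R'`
  with `R_af < R'`, `9M ≤ R'`, `2R' < R₁`, a bound `K` for `|χ'|` (`χ = Real.smoothTransition`,
  `Kerr.exists_bound_deriv_smoothTransition`), an admissible `ψ` and `0 ≤ s ≤ t`,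
  `farLeafFlux(t, 2R') ≤ 2 · leafFlux(s) + (1536 K / R') · ∫_{[s,t]} ∫_{R' ≤ ‖y‖ ≤ 2R'} leafFluxDensity(τ, y) dy dτ`
  (all for the foliation `Σ̃_τ(h♯_{R₁})`; the error, a `V`-energy through the collar annuli of the
  slices, is at most `∫_{[s,t]} localLeafFlux(τ, 2R') dτ`);
* the ingredients, reusable for the Morawetz and `r^p` currents: the specialised identity
  `Kerr.far_TCurrent_identity`, the continuity of the space-time integrand and of the collar majorant
  (`Kerr.continuous_far_TCurrent_integrand`, `Kerr.continuous_far_collar_majorant`), the pointwise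
  lower bound `Kerr.far_TCurrent_integrand_ge`, the support statements
  `Kerr.far_leafIntegrand_eq_zero`, `Kerr.far_TCurrent_integrand_support`, and the continuity of the
  cut-off leaf densities `IsAdmissibleKerrWave.continuous_far_leafDensity`.

Not here: the finiteness of `leafFlux` through `Σ̃_t(h♯_{R₁})` (it needs the same identity between the
*slice* `{t* = 0}`, on which the data are compactly supported, and the leaf — two different heights
— rather than between two leaves; the crude finite speed of propagation of the chart does not make
the wave vanish on the far part of `Σ̃₀(h♯_{R₁})`, which is asymptotically null), and every statement
with weights (`r^p`, Morawetz).

## The argument (DRSR §2.3.2 with a smeared future boundary)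

Apply `KerrSchild.cutoffModifiedCurrent_graph_identity_timeCutoff` (`KerrSchildTruncatedCurrent.lean`)
to the current `f J^T[ψ̃]` — `ψ̃` the extension of `ψ` by zero, `J^T` the coordinate current of
`T = ∂_{t*}` for `g⁻¹_{M,a}`, `f(x) = u_{R',R'}(x⃗)` the radial cut-off (`0` for `‖x⃗‖ ≤ R'`, `1` for
`‖x⃗‖ ≥ 2R'`), weight `ϖ = 0` — between the leaves `Σ̃_s`, `Σ̃_t` with the smeared cut-off
`ζ(T* − t*)`, `ζ = χ`: the hypotheses are those collected in `KerrFarRegionCutoff.lean` (local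
regularity on `{‖x⃗‖ > R_af}`, support of `ψ̃` below the time level `T*` by finite speed of
propagation). Since `□ψ̃ = 0` and `K^T = 0`, the space-time integrand is
`ζ ∑_μ (J^T)^μ ∂_μ f − ζ' f (J^T)⁰`; the second term is `≤ 0` (energy through the slices, dominant
energy condition: `−(J^T)⁰ ≥ 0`, `ζ' ≥ 0`, `f ≥ 0`) and the first is bounded by
`48 (∑_μ|∂_μ f|) ∑_μ (∂_μψ̃)² ≤ 768 (K/R') T[ψ](V, V)` on the collar `{R' ≤ ‖y‖ ≤ 2R'}`, where the
leaves are the slices (`h♯_{R₁} = 0` on `{‖y‖ ≤ R₁}`). Hence, with `E_T(Σ) = ∫ ζ f (−∑(J^T)^μ n_μ)`,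
`E_T(Σ̃_t ∩ {t* ≲ T*}) ≤ E_T(Σ̃_s) + 768 (K/R') ∫_{[s,t]} localLeafFlux(τ, 2R') dτ`; the comparability
`J^T n ≤ J^V n ≤ 2 J^T n` through the leaves in the far region (`KerrLeafEnergyComparison.lean`,
`H ≤ 1/8` for `‖x⃗‖ ≥ 9M`) converts `E_T` into `V`-fluxes, and `T* → ∞` (monotone convergence,
`E4.lintegral_le_of_forall_lintegral_timeCutoff_le`) removes the cut-off.

## References

* G. Moschidis, arXiv:1509.08489 = Ann. PDE 2 (2016), Lemma 4.5 and its proof (the regions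
  `𝓡(τ₁, τ₂) ∩ {t ≤ T*}`, the cut-off `χ_R`, the terms on `{t = T*}`) (key `Moschidis2016`).
* M. Dafermos, I. Rodnianski, Y. Shlapentokh-Rothman, arXiv:1402.7034 = Ann. of Math. 183 (2016),
  §2.3.2 ((ingeneralform), the `J^T` identity), §3.3 (hyperboloidal leaves), §4.1
  (key `DafermosRodnianskiShlapentokhrothman2014`).
* M. Dafermos, I. Rodnianski, arXiv:0910.4957, §3 (the far-region energy estimate entering the `r^p`
  hierarchy, (eq:1)) (key `DafermosRodnianski2010ICMP`).
-/

noncomputable section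

open Bundle Set TopologicalSpace Filter MeasureTheory Metric
open scoped Manifold ContDiff Topology ENNReal

namespace Literature.Geometry.Lorentzian

namespace Kerr

variable [Facts] [SliceFacts]

/-! ### The identity for the cut-off `∂_{t*}`-current between two leaves with a smeared time cut-off -/

/-- **The `∂_{t*}`-energy identity for the cut-off current `f J^T[ψ̃]` between a lower graph
`{t* = s + F₁(y)}` and the leaf `Σ̃_t(h♯_{R₁})` with the smeared future cut-off `χ(T* − t*)`**
(`χ = Real.smoothTransition`, `f(x) = u_{R',R'}(x⃗)`; `F₁` a `C²` height with `0 ≤ F₁ ≤ h♯_{R₁}` — the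
two cases of interest are `F₁ = h♯_{R₁}`, the leaf `Σ̃_s`, and `F₁ = 0`, the Kerr–Schild slice
`{t* = s}`): for an admissible `ψ`, `0 ≤ s ≤ t`, `R' > R_af`, and `ρ₀` the radius of
`IsAdmissibleKerrWave.exists_extend_eq_zero_of_lt`,
`∫ χ(T* − t − h♯) f ∑(J^T)^μ n^{h♯}_μ |_{Σ̃_t} dy − ∫ χ(T* − s − F₁) f ∑(J^T)^μ n^{F₁}_μ |_{(s + F₁(y), y)} dy
  = ∫ ∫_{(s + F₁(y), t + h♯(y)]} ( χ(T* − t') ∑_μ (J^T)^μ ∂_μ f − χ'(T* − t') f (J^T)⁰ )(t', y) dt' dy`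
— `KerrSchild.cutoffModifiedCurrent_graphs_identity_timeCutoff` with `ϖ = 0`, in which `□ψ̃ = 0` and
`K^T = 0` on the far region and `f = ∂f = 0` off it. DRSR arXiv:1402.7034, §2.3.2; Moschidis
arXiv:1509.08489, proof of Lemma 4.5. [cite: Moschidis2016, Lemma 4.5 (proof)] -/
theorem far_TCurrent_identity {M a R₁ R' : ℝ} (hMa : IsSubextremal M a) (hR₁ : 2 * M < R₁)
    (hR'af : afRadius a (rPlus M a) < R') {ψ : region a (rPlus M a) → ℝ}
    (hψ : IsAdmissibleKerrWave M a ψ) {ρ₀ : ℝ}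
    (hρ₀ : ∀ x : E4, 0 ≤ x 0 → ρ₀ + x 0 < E4.spatialNorm x →
      Function.extend Subtype.val ψ 0 x = 0 ∧ fderiv ℝ (Function.extend Subtype.val ψ 0) x = 0)
    {F₁ : E3 → ℝ} (hF₁ : ContDiff ℝ 2 F₁) (hF₁0 : ∀ y, 0 ≤ F₁ y)
    (hF₁h : ∀ y, F₁ y ≤ scriHeight M a R₁ y) {s t : ℝ} (hs : 0 ≤ s) (hst : s ≤ t) (T : ℝ) :
    (∫ y, Real.smoothTransition (T - (t + scriHeight M a R₁ y)) *
        (radialTransition R' R' y *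
          ∑ μ, KerrSchild.multiplierCurrent (inverseMetric M a) (fun (_ : E4) (ν : Fin 4) ↦ if ν = 0 then (1 : ℝ) else 0) (Function.extend Subtype.val ψ 0)
            (E4.ofTimeSpace (t + scriHeight M a R₁ y) y) μ * graphConormal (scriHeight M a R₁) y μ)) -
      ∫ y, Real.smoothTransition (T - (s + F₁ y)) *
        (radialTransition R' R' y *
          ∑ μ, KerrSchild.multiplierCurrent (inverseMetric M a) (fun (_ : E4) (ν : Fin 4) ↦ if ν = 0 then (1 : ℝ) else 0) (Function.extend Subtype.val ψ 0)
            (E4.ofTimeSpace (s + F₁ y) y) μ * graphConormal F₁ y μ) =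
      ∫ y, ∫ t' in Set.Ioc (s + F₁ y) (t + scriHeight M a R₁ y),
        (Real.smoothTransition (T - t') *
            ∑ μ, KerrSchild.multiplierCurrent (inverseMetric M a) (fun (_ : E4) (ν : Fin 4) ↦ if ν = 0 then (1 : ℝ) else 0) (Function.extend Subtype.val ψ 0)
              (E4.ofTimeSpace t' y) μ *
              fderiv ℝ (fun x : E4 ↦ radialTransition R' R' (E4.spatial x)) (E4.ofTimeSpace t' y)
                (E4.basisVector μ) -
          deriv Real.smoothTransition (T - t') *
            (radialTransition R' R' y *
              KerrSchild.multiplierCurrent (inverseMetric M a) (fun (_ : E4) (ν : Fin 4) ↦ if ν = 0 then (1 : ℝ) else 0) (Function.extend Subtype.val ψ 0)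
                (E4.ofTimeSpace t' y) 0)) := by
  have hM : 0 < M := hMa.pos
  have hR' : 0 < R' := (afRadius_pos a (rPlus M a)).trans hR'af
  have hRp : rPlus M a < R₁ := (rPlus_le_two_mul hM.le).trans_lt hR₁
  set Φ : E4 → ℝ := Function.extend Subtype.val ψ 0 with hΦ
  set f : E4 → ℝ := fun x ↦ radialTransition R' R' (E4.spatial x) with hf
  set U : Set E4 := {x | afRadius a (rPlus M a) < E4.spatialNorm x} with hU
  set h : E3 → ℝ := scriHeight M a R₁ with hh
  -- hypotheses of the abstract identity
  have hfU : tsupport f ⊆ U := fun x hx ↦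
    hR'af.trans_le (tsupport_radialTransition_comp_spatial_subset hR' hx)
  have hf1 : ContDiff ℝ 1 f := contDiff_radialTransition_comp_spatial hR'
  have hmemU : ∀ x ∈ U, x ∈ region a (rPlus M a) := fun x hx ↦ mem_region_of_afRadius_lt_spatialNorm hx
  have hG : ∀ x ∈ U, ∀ μ ν, ContDiffAt ℝ 1 (fun y ↦ inverseMetric M a y μ ν) x := fun x hx μ ν ↦
    contDiffAt_inverseMetric M a (radius_pos_of_mem_region (hmemU x hx)) μ ν
  have hsymm : ∀ x ∈ U, ∀ μ ν, inverseMetric M a x μ ν = inverseMetric M a x ν μ := fun x _ μ ν ↦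
    inverseMetric_symm M a x μ ν
  have hX : ∀ x ∈ U, ∀ α, ContDiffAt ℝ 1 (fun y ↦ (fun (_ : E4) (ν : Fin 4) ↦ if ν = 0 then (1 : ℝ) else 0) y α) x := fun _ _ _ ↦ contDiffAt_const
  have hϖ : ∀ x ∈ U, ContDiffAt ℝ 2 (fun _ : E4 ↦ (0 : ℝ)) x := fun _ _ ↦ contDiffAt_const
  have hw : ∀ x ∈ U, ContDiffAt ℝ 2 Φ x := fun x hx ↦ hψ.contDiffAt_extend_of_mem (hmemU x hx)
  have hζ : ContDiff ℝ 1 Real.smoothTransition := Real.smoothTransition.contDiff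
  have hζ0 : ∀ σ ≤ (0 : ℝ), Real.smoothTransition σ = 0 := fun σ hσ ↦
    Real.smoothTransition.zero_of_nonpos hσ
  have hF : ContDiff ℝ 2 h := hMa.contDiff_scriHeight hRp
  have hF₂ : ContDiff ℝ 2 fun y ↦ (t - s) + h y := contDiff_const.add hF
  have hle : ∀ y, F₁ y ≤ (t - s) + h y := fun y ↦ by linarith [hF₁h y, sub_nonneg.2 hst]
  have hfar : ∀ x : E4, ρ₀ + T < E4.spatialNorm x → s + F₁ (E4.spatial x) ≤ x 0 →
      x 0 ≤ s + ((t - s) + h (E4.spatial x)) → x 0 < T → f x = 0 ∨ (Φ x = 0 ∧ fderiv ℝ Φ x = 0) := by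
    intro x hxρ hx1 _ hxT
    right
    have hx0 : 0 ≤ x 0 := by linarith [hF₁0 (E4.spatial x)]
    exact hρ₀ x hx0 (by linarith)
  have hid := KerrSchild.cutoffModifiedCurrent_graphs_identity_timeCutoff (G := inverseMetric M a)
    (X := (fun (_ : E4) (ν : Fin 4) ↦ if ν = 0 then (1 : ℝ) else 0)) (ϖ := fun _ ↦ 0) (w := Φ) (f := f) hfU hf1 hG hsymm hX hϖ hw hζ hζ0 hF₁ hF₂ hle
    (τ := s) (T := T) hfar
  -- the Lagrangian terms vanish for `ϖ = 0`
  have hL : ∀ x μ, KerrSchild.lagrangianCurrent (inverseMetric M a) (fun _ ↦ (0 : ℝ)) Φ x μ = 0 := by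
    intro x μ
    simp [KerrSchild.lagrangianCurrent]
  have hbox0 : ∀ x, KerrSchild.waveOperator (inverseMetric M a) (fun _ : E4 ↦ (0 : ℝ)) x = 0 := by
    intro x
    simp [KerrSchild.waveOperator]
  have hfval : ∀ (τ : ℝ) (y : E3), f (E4.ofTimeSpace τ y) = radialTransition R' R' y := by
    intro τ y
    simp [hf]
  have hn : ∀ (y : E3) (μ : Fin 4),
      graphConormal (fun y ↦ t - s + h y) y μ = graphConormal h y μ := by
    intro y μ
    refine Fin.cases rfl (fun i ↦ ?_) μ
    simp only [graphConormal_succ, partialE3, fderiv_const_add]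
  simp only [hL, mul_zero, add_zero, show ∀ y, s + (t - s + h y) = t + h y from fun y ↦ by ring,
    hfval, hn] at hid
  rw [hid]
  -- the space-time integrand: `□ψ̃ = 0`, `K^T = 0` on `U`, and `f = ∂f = 0` off `tsupport f`
  refine congrArg (fun g : E3 → ℝ ↦ ∫ y, g y) (funext fun y ↦ ?_)
  refine setIntegral_congr_fun measurableSet_Ioc fun t' _ ↦ ?_
  have hkey : radialTransition R' R' y *
      ((∑ α, (fun (_ : E4) (ν : Fin 4) ↦ if ν = 0 then (1 : ℝ) else 0) (E4.ofTimeSpace t' y) α *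
            fderiv ℝ Φ (E4.ofTimeSpace t' y) (E4.basisVector α) +
          4⁻¹ * (0 * Φ (E4.ofTimeSpace t' y))) *
        KerrSchild.waveOperator (inverseMetric M a) Φ (E4.ofTimeSpace t' y) +
      (KerrSchild.multiplierBulk (inverseMetric M a)
          (fun (_ : E4) (ν : Fin 4) ↦ if ν = 0 then (1 : ℝ) else 0) Φ (E4.ofTimeSpace t' y) +
        4⁻¹ * (0 * ∑ α, ∑ β, inverseMetric M a (E4.ofTimeSpace t' y) α β *
          fderiv ℝ Φ (E4.ofTimeSpace t' y) (E4.basisVector α) *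
            fderiv ℝ Φ (E4.ofTimeSpace t' y) (E4.basisVector β)) -
        8⁻¹ * KerrSchild.waveOperator (inverseMetric M a) (fun _ : E4 ↦ (0 : ℝ)) (E4.ofTimeSpace t' y) *
          Φ (E4.ofTimeSpace t' y) ^ 2)) = 0 := by
    by_cases hx : E4.ofTimeSpace t' y ∈ U
    · rw [hψ.waveOperator_extend_eq_zero (hmemU _ hx),
        multiplierBulk_timeTranslation_eq_zero M a Φ (radius_pos_of_mem_region (hmemU _ hx)), hbox0]
      ring
    · have hx' : E4.ofTimeSpace t' y ∉ tsupport f := fun h' ↦ hx (hfU h')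
      rw [← hfval t' y, image_eq_zero_of_notMem_tsupport hx', zero_mul]
  rw [hkey, zero_add]

/-! ### The space-time integrand: continuity, support, and the lower bound by the collar energy -/

/-- **The space-time integrand is continuous on `ℝ⁴`**: for the far cut-off `f` and an admissible
`ψ`, `x ↦ χ(T − x⁰) ∑_μ (J^T)^μ[ψ̃](x) ∂_μ f(x) − χ'(T − x⁰) f(x) (J^T)⁰[ψ̃](x)` is continuous (the
currents are continuous on the far region, which contains `tsupport f ⊇ tsupport ∂_μ f`).
[folklore] -/
theorem continuous_far_TCurrent_integrand {M a R' : ℝ} (hR'af : afRadius a (rPlus M a) < R')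
    {ψ : region a (rPlus M a) → ℝ} (hψ : IsAdmissibleKerrWave M a ψ) (T : ℝ) :
    Continuous fun x : E4 ↦
      Real.smoothTransition (T - x 0) *
          ∑ μ, KerrSchild.multiplierCurrent (inverseMetric M a) (fun (_ : E4) (ν : Fin 4) ↦ if ν = 0 then (1 : ℝ) else 0) (Function.extend Subtype.val ψ 0) x μ *
            fderiv ℝ (fun z : E4 ↦ radialTransition R' R' (E4.spatial z)) x (E4.basisVector μ) -
        deriv Real.smoothTransition (T - x 0) *
          (radialTransition R' R' (E4.spatial x) *
            KerrSchild.multiplierCurrent (inverseMetric M a) (fun (_ : E4) (ν : Fin 4) ↦ if ν = 0 then (1 : ℝ) else 0) (Function.extend Subtype.val ψ 0) x 0) := by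
  have hR' : 0 < R' := (afRadius_pos a (rPlus M a)).trans hR'af
  have hf1 : ContDiff ℝ 1 fun z : E4 ↦ radialTransition R' R' (E4.spatial z) :=
    contDiff_radialTransition_comp_spatial hR'
  have hfU : tsupport (fun z : E4 ↦ radialTransition R' R' (E4.spatial z)) ⊆
      {x : E4 | afRadius a (rPlus M a) < E4.spatialNorm x} := fun x hx ↦
    hR'af.trans_le (tsupport_radialTransition_comp_spatial_subset hR' hx)
  have hX : ∀ z : E4, afRadius a (rPlus M a) < E4.spatialNorm z → ∀ α,
      ContDiffAt ℝ 1 (fun y ↦ (fun (_ : E4) (ν : Fin 4) ↦ if ν = 0 then (1 : ℝ) else 0) y α) z := fun _ _ _ ↦ contDiffAt_const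
  have hζ : Continuous fun x : E4 ↦ Real.smoothTransition (T - x 0) :=
    Real.smoothTransition.continuous.comp (continuous_const.sub (E4.dx 0).continuous)
  have hζ' : Continuous fun x : E4 ↦ deriv Real.smoothTransition (T - x 0) :=
    (Real.smoothTransition.contDiff.continuous_deriv le_rfl).comp
      (continuous_const.sub (E4.dx 0).continuous)
  have h1 : ∀ μ, Continuous fun x : E4 ↦
      fderiv ℝ (fun z : E4 ↦ radialTransition R' R' (E4.spatial z)) x (E4.basisVector μ) *
        KerrSchild.multiplierCurrent (inverseMetric M a) (fun (_ : E4) (ν : Fin 4) ↦ if ν = 0 then (1 : ℝ) else 0) (Function.extend Subtype.val ψ 0) x μ :=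
    fun μ ↦ hψ.continuous_mul_multiplierCurrent
      ((hf1.continuous_fderiv one_ne_zero).clm_apply continuous_const)
      ((tsupport_fderiv_apply_subset ℝ (E4.basisVector μ)).trans hfU) hX μ
  have h2 : Continuous fun x : E4 ↦ radialTransition R' R' (E4.spatial x) *
      KerrSchild.multiplierCurrent (inverseMetric M a) (fun (_ : E4) (ν : Fin 4) ↦ if ν = 0 then (1 : ℝ) else 0) (Function.extend Subtype.val ψ 0) x 0 :=
    hψ.continuous_mul_multiplierCurrent hf1.continuous hfU hX 0
  have hsum : Continuous fun x : E4 ↦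
      ∑ μ, KerrSchild.multiplierCurrent (inverseMetric M a) (fun (_ : E4) (ν : Fin 4) ↦ if ν = 0 then (1 : ℝ) else 0) (Function.extend Subtype.val ψ 0) x μ *
        fderiv ℝ (fun z : E4 ↦ radialTransition R' R' (E4.spatial z)) x (E4.basisVector μ) := by
    refine continuous_finsetSum _ fun μ _ ↦ ?_
    simpa only [mul_comm] using h1 μ
  exact (hζ.mul hsum).sub (hζ'.mul h2)

/-- **The collar majorant is continuous on `ℝ⁴`**:
`x ↦ χ(T − x⁰) · 48 (∑_μ |∂_μ f(x)|) ∑_μ (∂_μψ̃)²(x)`. [folklore] -/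
theorem continuous_far_collar_majorant {M a R' : ℝ} (hR'af : afRadius a (rPlus M a) < R')
    {ψ : region a (rPlus M a) → ℝ} (hψ : IsAdmissibleKerrWave M a ψ) (T : ℝ) :
    Continuous fun x : E4 ↦
      Real.smoothTransition (T - x 0) *
        (48 * (∑ μ, |fderiv ℝ (fun z : E4 ↦ radialTransition R' R' (E4.spatial z)) x (E4.basisVector μ)|) *
          ∑ μ, fderiv ℝ (Function.extend Subtype.val ψ 0) x (E4.basisVector μ) ^ 2) := by
  have hR' : 0 < R' := (afRadius_pos a (rPlus M a)).trans hR'af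
  have hf1 : ContDiff ℝ 1 fun z : E4 ↦ radialTransition R' R' (E4.spatial z) :=
    contDiff_radialTransition_comp_spatial hR'
  have hfU : tsupport (fun z : E4 ↦ radialTransition R' R' (E4.spatial z)) ⊆
      {x : E4 | afRadius a (rPlus M a) < E4.spatialNorm x} := fun x hx ↦
    hR'af.trans_le (tsupport_radialTransition_comp_spatial_subset hR' hx)
  have hζ : Continuous fun x : E4 ↦ Real.smoothTransition (T - x 0) :=
    Real.smoothTransition.continuous.comp (continuous_const.sub (E4.dx 0).continuous)
  have h1 : ∀ μ, Continuous fun x : E4 ↦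
      |fderiv ℝ (fun z : E4 ↦ radialTransition R' R' (E4.spatial z)) x (E4.basisVector μ)| *
        ∑ κ, fderiv ℝ (Function.extend Subtype.val ψ 0) x (E4.basisVector κ) ^ 2 :=
    fun μ ↦ hψ.continuous_mul_sum_sq_fderiv_extend
      (((hf1.continuous_fderiv one_ne_zero).clm_apply continuous_const).abs)
      ((tsupport_abs_fderiv_apply_subset _ (E4.basisVector μ)).trans hfU)
  have hsum : Continuous fun x : E4 ↦
      (∑ μ, |fderiv ℝ (fun z : E4 ↦ radialTransition R' R' (E4.spatial z)) x (E4.basisVector μ)|) *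
        ∑ κ, fderiv ℝ (Function.extend Subtype.val ψ 0) x (E4.basisVector κ) ^ 2 := by
    have : (fun x : E4 ↦
        (∑ μ, |fderiv ℝ (fun z : E4 ↦ radialTransition R' R' (E4.spatial z)) x (E4.basisVector μ)|) *
          ∑ κ, fderiv ℝ (Function.extend Subtype.val ψ 0) x (E4.basisVector κ) ^ 2) =
        fun x ↦ ∑ μ, |fderiv ℝ (fun z : E4 ↦ radialTransition R' R' (E4.spatial z)) x (E4.basisVector μ)| *
          ∑ κ, fderiv ℝ (Function.extend Subtype.val ψ 0) x (E4.basisVector κ) ^ 2 := by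
      funext x; rw [Finset.sum_mul]
    rw [this]
    exact continuous_finsetSum _ fun μ _ ↦ h1 μ
  have h48 : Continuous fun x : E4 ↦
      (48 : ℝ) * ((∑ μ, |fderiv ℝ (fun z : E4 ↦ radialTransition R' R' (E4.spatial z)) x (E4.basisVector μ)|) *
        ∑ κ, fderiv ℝ (Function.extend Subtype.val ψ 0) x (E4.basisVector κ) ^ 2) :=
    continuous_const.mul hsum
  have h48' : Continuous fun x : E4 ↦
      (48 * ∑ μ, |fderiv ℝ (fun z : E4 ↦ radialTransition R' R' (E4.spatial z)) x (E4.basisVector μ)|) *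
        ∑ κ, fderiv ℝ (Function.extend Subtype.val ψ 0) x (E4.basisVector κ) ^ 2 := by
    simpa only [mul_assoc] using h48
  exact hζ.mul h48'

/-- **The space-time integrand is bounded below by the collar majorant**, at every point: with
`D(x) = χ(T − x⁰) ∑(J^T)^μ ∂_μ f − χ'(T − x⁰) f (J^T)⁰` and
`m(x) = 48 χ(T − x⁰)(∑|∂_μ f|)∑(∂_μψ̃)²`, one has `−m(x) ≤ D(x)` (off `tsupport f` both vanish; on it the
point is in the far region `{‖x⃗‖ ≥ R'}`, where `−(J^T)⁰ ≥ 0` (energy through the slices,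
`KerrLeafEnergyComparison.lean`), `χ' ≥ 0`, `f ≥ 0`, and
`|∑(J^T)^μ ∂_μ f| ≤ 48 (∑|∂_μ f|) ∑(∂ψ̃)²` (`Kerr.abs_sum_multiplierCurrent_mul_fderiv_le`)).
[cite: Moschidis2016, Lemma 4.5 (proof)] -/
theorem far_TCurrent_integrand_ge {M a R₁ R' : ℝ} (hMa : IsSubextremal M a) (hR₁ : 2 * M < R₁)
    (hR'af : afRadius a (rPlus M a) < R') (hR'9 : 9 * M ≤ R') {ψ : region a (rPlus M a) → ℝ}
    (hψ : IsAdmissibleKerrWave M a ψ) (T : ℝ) (x : E4) :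
    -(Real.smoothTransition (T - x 0) *
        (48 * (∑ μ, |fderiv ℝ (fun z : E4 ↦ radialTransition R' R' (E4.spatial z)) x (E4.basisVector μ)|) *
          ∑ μ, fderiv ℝ (Function.extend Subtype.val ψ 0) x (E4.basisVector μ) ^ 2)) ≤
      Real.smoothTransition (T - x 0) *
          ∑ μ, KerrSchild.multiplierCurrent (inverseMetric M a) (fun (_ : E4) (ν : Fin 4) ↦ if ν = 0 then (1 : ℝ) else 0) (Function.extend Subtype.val ψ 0) x μ *
            fderiv ℝ (fun z : E4 ↦ radialTransition R' R' (E4.spatial z)) x (E4.basisVector μ) -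
        deriv Real.smoothTransition (T - x 0) *
          (radialTransition R' R' (E4.spatial x) *
            KerrSchild.multiplierCurrent (inverseMetric M a) (fun (_ : E4) (ν : Fin 4) ↦ if ν = 0 then (1 : ℝ) else 0) (Function.extend Subtype.val ψ 0) x 0) := by
  have hM : 0 < M := hMa.pos
  have hR' : 0 < R' := (afRadius_pos a (rPlus M a)).trans hR'af
  have hζ0 : 0 ≤ Real.smoothTransition (T - x 0) := Real.smoothTransition.nonneg _
  have hζ'0 : 0 ≤ deriv Real.smoothTransition (T - x 0) :=
    Real.smoothTransition.monotone.deriv_nonneg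
  have hf0 : 0 ≤ radialTransition R' R' (E4.spatial x) := radialTransition_nonneg _ _ _
  by_cases hx : x ∈ tsupport fun z : E4 ↦ radialTransition R' R' (E4.spatial z)
  · -- a point of the far region
    have hxR : R' ≤ E4.spatialNorm x := tsupport_radialTransition_comp_spatial_subset hR' hx
    obtain ⟨hmem, hH, -, -, -, hslice⟩ := far_point_package hMa hR₁ hR'af hR'9 hψ hxR
    have hr : 0 < radius a x := radius_pos_of_mem_region hmem
    have h2H : 2 * scalarH M a x ≤ 1 := by linarith
    have hXb : ∀ α, |(fun (_ : E4) (ν : Fin 4) ↦ if ν = 0 then (1 : ℝ) else 0) x α| ≤ 1 := by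
      intro α
      show |(if α = 0 then (1 : ℝ) else 0)| ≤ 1
      split_ifs <;> simp
    have hνb : ∀ μ, |fderiv ℝ (fun z : E4 ↦ radialTransition R' R' (E4.spatial z)) x (E4.basisVector μ)| ≤
        ∑ κ, |fderiv ℝ (fun z : E4 ↦ radialTransition R' R' (E4.spatial z)) x (E4.basisVector κ)| :=
      fun μ ↦ Finset.single_le_sum (f := fun κ ↦
        |fderiv ℝ (fun z : E4 ↦ radialTransition R' R' (E4.spatial z)) x (E4.basisVector κ)|)
        (fun κ _ ↦ abs_nonneg _) (Finset.mem_univ μ)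
    have hν0 : 0 ≤ ∑ κ, |fderiv ℝ (fun z : E4 ↦ radialTransition R' R' (E4.spatial z)) x (E4.basisVector κ)| :=
      Finset.sum_nonneg fun κ _ ↦ abs_nonneg _
    have habs := abs_sum_multiplierCurrent_mul_fderiv_le hM.le hr h2H (X := (fun (_ : E4) (ν : Fin 4) ↦ if ν = 0 then (1 : ℝ) else 0))
      (w := Function.extend Subtype.val ψ 0) (f := fun z : E4 ↦ radialTransition R' R' (E4.spatial z))
      zero_le_one hν0 hXb hνb
    -- names for the recurring quantities
    set A : ℝ := ∑ μ, KerrSchild.multiplierCurrent (inverseMetric M a) (fun (_ : E4) (ν : Fin 4) ↦ if ν = 0 then (1 : ℝ) else 0)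
      (Function.extend Subtype.val ψ 0) x μ *
        fderiv ℝ (fun z : E4 ↦ radialTransition R' R' (E4.spatial z)) x (E4.basisVector μ) with hA_def
    set ν : ℝ := ∑ κ, |fderiv ℝ (fun z : E4 ↦ radialTransition R' R' (E4.spatial z)) x (E4.basisVector κ)|
      with hν_def
    set S : ℝ := ∑ μ, fderiv ℝ (Function.extend Subtype.val ψ 0) x (E4.basisVector μ) ^ 2 with hS_def
    set ζ : ℝ := Real.smoothTransition (T - x 0) with hζ_def
    set ζ' : ℝ := deriv Real.smoothTransition (T - x 0) with hζ'_def
    set fx : ℝ := radialTransition R' R' (E4.spatial x) with hfx_def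
    set J0 : ℝ := KerrSchild.multiplierCurrent (inverseMetric M a) (fun (_ : E4) (ν : Fin 4) ↦ if ν = 0 then (1 : ℝ) else 0)
      (Function.extend Subtype.val ψ 0) x 0 with hJ0_def
    have hA : -(48 * ν * S) ≤ A := by
      have h := (abs_le.1 habs).1
      linarith [h]
    have h1 : -(ζ * (48 * ν * S)) ≤ ζ * A := by
      have := mul_le_mul_of_nonneg_left hA hζ0
      linarith [this]
    have h2 : 0 ≤ -(ζ' * (fx * J0)) := by
      have : 0 ≤ ζ' * (fx * -J0) := mul_nonneg hζ'0 (mul_nonneg hf0 hslice)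
      linarith [this]
    linarith [h1, h2]
  · -- off the support of the cut-off everything vanishes
    have hdf : ∀ μ, fderiv ℝ (fun z : E4 ↦ radialTransition R' R' (E4.spatial z)) x (E4.basisVector μ) = 0 :=
      fderiv_comp_spatial_basisVector_eq_zero hx
    have hfx : (fun z : E4 ↦ radialTransition R' R' (E4.spatial z)) x = 0 :=
      image_eq_zero_of_notMem_tsupport (f := fun z : E4 ↦ radialTransition R' R' (E4.spatial z)) hx
    simp only at hfx
    simp [hdf, hfx]

/-- **The plate integrand `x ↦ χ'(T − x⁰) f(x) (J^T)⁰[ψ̃](x)` is continuous on `ℝ⁴`.**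
[folklore] -/
theorem continuous_far_plate_integrand {M a R' : ℝ} (hR'af : afRadius a (rPlus M a) < R')
    {ψ : region a (rPlus M a) → ℝ} (hψ : IsAdmissibleKerrWave M a ψ) (T : ℝ) :
    Continuous fun x : E4 ↦ deriv Real.smoothTransition (T - x 0) *
      (radialTransition R' R' (E4.spatial x) *
        KerrSchild.multiplierCurrent (inverseMetric M a) (fun (_ : E4) (ν : Fin 4) ↦ if ν = 0 then (1 : ℝ) else 0) (Function.extend Subtype.val ψ 0) x 0) := by
  have hR' : 0 < R' := (afRadius_pos a (rPlus M a)).trans hR'af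
  have hf1 : ContDiff ℝ 1 fun z : E4 ↦ radialTransition R' R' (E4.spatial z) :=
    contDiff_radialTransition_comp_spatial hR'
  have hfU : tsupport (fun z : E4 ↦ radialTransition R' R' (E4.spatial z)) ⊆
      {x : E4 | afRadius a (rPlus M a) < E4.spatialNorm x} := fun x hx ↦
    hR'af.trans_le (tsupport_radialTransition_comp_spatial_subset hR' hx)
  have hX : ∀ z : E4, afRadius a (rPlus M a) < E4.spatialNorm z → ∀ α,
      ContDiffAt ℝ 1 (fun y ↦ (fun (_ : E4) (ν : Fin 4) ↦ if ν = 0 then (1 : ℝ) else 0) y α) z := fun _ _ _ ↦ contDiffAt_const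
  have hζ' : Continuous fun x : E4 ↦ deriv Real.smoothTransition (T - x 0) :=
    (Real.smoothTransition.contDiff.continuous_deriv le_rfl).comp
      (continuous_const.sub (E4.dx 0).continuous)
  exact hζ'.mul (hψ.continuous_mul_multiplierCurrent hf1.continuous hfU hX 0)

/-- **The cut-off part of the space-time integrand is bounded below by the collar majorant**:
`−m(x) ≤ χ(T − x⁰) ∑_μ (J^T)^μ ∂_μ f` (the plate part `−χ' f (J^T)⁰ ≥ 0` of
`far_TCurrent_integrand_ge` removed). [cite: Moschidis2016, Lemma 4.5 (proof)] -/
theorem far_TCurrent_cutoff_integrand_ge {M a R₁ R' : ℝ} (hMa : IsSubextremal M a) (hR₁ : 2 * M < R₁)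
    (hR'af : afRadius a (rPlus M a) < R') (hR'9 : 9 * M ≤ R') {ψ : region a (rPlus M a) → ℝ}
    (hψ : IsAdmissibleKerrWave M a ψ) (T : ℝ) (x : E4) :
    -(Real.smoothTransition (T - x 0) *
        (48 * (∑ μ, |fderiv ℝ (fun z : E4 ↦ radialTransition R' R' (E4.spatial z)) x (E4.basisVector μ)|) *
          ∑ μ, fderiv ℝ (Function.extend Subtype.val ψ 0) x (E4.basisVector μ) ^ 2)) ≤
      Real.smoothTransition (T - x 0) *
        ∑ μ, KerrSchild.multiplierCurrent (inverseMetric M a) (fun (_ : E4) (ν : Fin 4) ↦ if ν = 0 then (1 : ℝ) else 0) (Function.extend Subtype.val ψ 0) x μ *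
          fderiv ℝ (fun z : E4 ↦ radialTransition R' R' (E4.spatial z)) x (E4.basisVector μ) := by
  have hM : 0 < M := hMa.pos
  have hR' : 0 < R' := (afRadius_pos a (rPlus M a)).trans hR'af
  have hζ0 : 0 ≤ Real.smoothTransition (T - x 0) := Real.smoothTransition.nonneg _
  by_cases hx : x ∈ tsupport fun z : E4 ↦ radialTransition R' R' (E4.spatial z)
  · have hxR : R' ≤ E4.spatialNorm x := tsupport_radialTransition_comp_spatial_subset hR' hx
    obtain ⟨hmem, hH, -, -, -, -⟩ := far_point_package hMa hR₁ hR'af hR'9 hψ hxR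
    have hr : 0 < radius a x := radius_pos_of_mem_region hmem
    have h2H : 2 * scalarH M a x ≤ 1 := by linarith
    have hXb : ∀ α, |(fun (_ : E4) (ν : Fin 4) ↦ if ν = 0 then (1 : ℝ) else 0) x α| ≤ 1 := by
      intro α
      show |(if α = 0 then (1 : ℝ) else 0)| ≤ 1
      split_ifs <;> simp
    have hνb : ∀ μ, |fderiv ℝ (fun z : E4 ↦ radialTransition R' R' (E4.spatial z)) x (E4.basisVector μ)| ≤
        ∑ κ, |fderiv ℝ (fun z : E4 ↦ radialTransition R' R' (E4.spatial z)) x (E4.basisVector κ)| :=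
      fun μ ↦ Finset.single_le_sum (f := fun κ ↦
        |fderiv ℝ (fun z : E4 ↦ radialTransition R' R' (E4.spatial z)) x (E4.basisVector κ)|)
        (fun κ _ ↦ abs_nonneg _) (Finset.mem_univ μ)
    have hν0 : 0 ≤ ∑ κ, |fderiv ℝ (fun z : E4 ↦ radialTransition R' R' (E4.spatial z)) x (E4.basisVector κ)| :=
      Finset.sum_nonneg fun κ _ ↦ abs_nonneg _
    have habs := abs_sum_multiplierCurrent_mul_fderiv_le hM.le hr h2H (X := (fun (_ : E4) (ν : Fin 4) ↦ if ν = 0 then (1 : ℝ) else 0))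
      (w := Function.extend Subtype.val ψ 0) (f := fun z : E4 ↦ radialTransition R' R' (E4.spatial z))
      zero_le_one hν0 hXb hνb
    have hA := (abs_le.1 habs).1
    have := mul_le_mul_of_nonneg_left hA hζ0
    linarith [this]
  · have hdf : ∀ μ, fderiv ℝ (fun z : E4 ↦ radialTransition R' R' (E4.spatial z)) x (E4.basisVector μ) = 0 :=
      fderiv_comp_spatial_basisVector_eq_zero hx
    simp [hdf]

/-! ### The flux integrands through the leaves: continuity and support -/

omit [Facts] [SliceFacts] in
/-- The components of the Kerr–Schild time vector are `C^n` at the points with `r > 0`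
(`Kerr.contDiffAt_timeVector`). [folklore] -/
theorem contDiffAt_timeVector_apply (M a : ℝ) {x : E4} (hx : 0 < radius a x) {n : WithTop ℕ∞}
    (α : Fin 4) : ContDiffAt ℝ n (fun y ↦ timeVector M a y α) x :=
  contDiffAt_euclidean.1 (contDiffAt_timeVector M a hx) α

omit [Facts] [SliceFacts] in
/-- The graph conormal of a `C¹` height, as a function on `ℝ⁴` through the spatial part, has
continuous components. [folklore] -/
theorem continuous_graphConormal_comp_spatial {F : E3 → ℝ} (hF : ContDiff ℝ 1 F) (μ : Fin 4) :
    Continuous fun x : E4 ↦ graphConormal F (E4.spatial x) μ := by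
  refine Fin.cases ?_ (fun i ↦ ?_) μ
  · simp only [graphConormal_zero]
    exact continuous_const
  · simp only [graphConormal_succ, partialE3]
    exact (((hF.continuous_fderiv one_ne_zero).clm_apply continuous_const).comp
      E4.spatial.continuous).neg

/-- **The cut-off leaf energy density is continuous on `ℝ⁴`**: for a multiplier `X` with `C¹`
components on the far region and a `C¹` height `F`,
`x ↦ f(x) · (−∑_μ (J^X)^μ[ψ̃](x) n_μ(x⃗))`, `n = graphConormal F`, is continuous. [folklore] -/
theorem _root_.Literature.Geometry.Lorentzian.IsAdmissibleKerrWave.continuous_far_leafDensity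
    {M a R' : ℝ} (hR'af : afRadius a (rPlus M a) < R') {ψ : region a (rPlus M a) → ℝ}
    (hψ : IsAdmissibleKerrWave M a ψ) {X : E4 → Fin 4 → ℝ}
    (hX : ∀ z : E4, afRadius a (rPlus M a) < E4.spatialNorm z → ∀ α, ContDiffAt ℝ 1 (fun y ↦ X y α) z)
    {F : E3 → ℝ} (hF : ContDiff ℝ 1 F) :
    Continuous fun x : E4 ↦ radialTransition R' R' (E4.spatial x) *
      -∑ μ, KerrSchild.multiplierCurrent (inverseMetric M a) X (Function.extend Subtype.val ψ 0) x μ *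
        graphConormal F (E4.spatial x) μ := by
  have hR' : 0 < R' := (afRadius_pos a (rPlus M a)).trans hR'af
  have hf1 : ContDiff ℝ 1 fun z : E4 ↦ radialTransition R' R' (E4.spatial z) :=
    contDiff_radialTransition_comp_spatial hR'
  have hfU : tsupport (fun z : E4 ↦ radialTransition R' R' (E4.spatial z)) ⊆
      {x : E4 | afRadius a (rPlus M a) < E4.spatialNorm x} := fun x hx ↦
    hR'af.trans_le (tsupport_radialTransition_comp_spatial_subset hR' hx)
  have h1 : ∀ μ, Continuous fun x : E4 ↦ (radialTransition R' R' (E4.spatial x) *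
      KerrSchild.multiplierCurrent (inverseMetric M a) X (Function.extend Subtype.val ψ 0) x μ) *
        graphConormal F (E4.spatial x) μ := fun μ ↦
    (hψ.continuous_mul_multiplierCurrent hf1.continuous hfU hX μ).mul
      (continuous_graphConormal_comp_spatial hF μ)
  have heq : (fun x : E4 ↦ radialTransition R' R' (E4.spatial x) *
      -∑ μ, KerrSchild.multiplierCurrent (inverseMetric M a) X (Function.extend Subtype.val ψ 0) x μ *
        graphConormal F (E4.spatial x) μ) =
      fun x ↦ -∑ μ, (radialTransition R' R' (E4.spatial x) *
        KerrSchild.multiplierCurrent (inverseMetric M a) X (Function.extend Subtype.val ψ 0) x μ) *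
          graphConormal F (E4.spatial x) μ := by
    funext x
    rw [mul_neg, Finset.mul_sum]
    congr 1
    exact Finset.sum_congr rfl fun μ _ ↦ by ring
  rw [heq]
  exact (continuous_finsetSum _ fun μ _ ↦ h1 μ).neg

omit [Facts] [SliceFacts] in
/-- **Support of the cut-off leaf integrands** (finite speed of propagation): if `ψ̃ = dψ̃ = 0` at
the points with `x⁰ ≥ 0`, `‖x⃗‖ > ρ₀ + x⁰`, then for `τ ≥ 0`, a height `F ≥ 0` and `y` with
`‖y‖ > ρ₀ + T`, the truncated density `χ(T − τ − F(y)) f (∑(J^X)^μ n_μ)` vanishes at the leaf point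
over `y` (either the leaf is above the level `T` there, or `ψ̃` vanishes to first order).
[cite: DafermosRodnianskiShlapentokhrothman2014, §4.1] -/
theorem far_leafIntegrand_eq_zero {M a R' : ℝ} {ψ : region a (rPlus M a) → ℝ} {ρ₀ : ℝ}
    (hρ₀ : ∀ x : E4, 0 ≤ x 0 → ρ₀ + x 0 < E4.spatialNorm x →
      Function.extend Subtype.val ψ 0 x = 0 ∧ fderiv ℝ (Function.extend Subtype.val ψ 0) x = 0)
    (X : E4 → Fin 4 → ℝ) {F : E3 → ℝ} (hF0 : ∀ y, 0 ≤ F y) {τ T : ℝ} (hτ : 0 ≤ τ) {y : E3}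
    (hy : ρ₀ + T < ‖y‖) :
    Real.smoothTransition (T - (τ + F y)) * (radialTransition R' R' y *
      ∑ μ, KerrSchild.multiplierCurrent (inverseMetric M a) X (Function.extend Subtype.val ψ 0)
        (E4.ofTimeSpace (τ + F y) y) μ * graphConormal F y μ) = 0 := by
  rcases le_or_gt T (τ + F y) with hT | hT
  · rw [Real.smoothTransition.zero_of_nonpos (by linarith), zero_mul]
  · have h0 : 0 ≤ (E4.ofTimeSpace (τ + F y) y) 0 := by
      rw [E4.ofTimeSpace_apply_zero]; linarith [hF0 y]
    have hfar : ρ₀ + (E4.ofTimeSpace (τ + F y) y) 0 < E4.spatialNorm (E4.ofTimeSpace (τ + F y) y) := by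
      rw [E4.ofTimeSpace_apply_zero, E4.spatialNorm_ofTimeSpace]; linarith
    have hd := (hρ₀ _ h0 hfar).2
    simp [KerrSchild.multiplierCurrent_eq_zero_of_fderiv_eq_zero _ _ hd]

omit [Facts] [SliceFacts] in
/-- **Support of the space-time integrand and of the collar majorant**: under the same hypothesis
on `ψ̃`, if at a point `(t', y)` with `t' ≥ 0` the space-time integrand
`χ(T − t') ∑(J^T)^μ ∂_μ f − χ'(T − t') f (J^T)⁰` or the collar majorant
`48 χ(T − t') (∑|∂_μ f|) ∑(∂_μψ̃)²` is nonzero, then `t' ≤ T` (above the level both `χ(T − t')` and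
`χ'(T − t')` vanish) and `‖y‖ ≤ ρ₀ + T` (beyond, `dψ̃ = 0`). [folklore] -/
theorem far_TCurrent_integrand_support {M a R' : ℝ} {ψ : region a (rPlus M a) → ℝ} {ρ₀ : ℝ}
    (hρ₀ : ∀ x : E4, 0 ≤ x 0 → ρ₀ + x 0 < E4.spatialNorm x →
      Function.extend Subtype.val ψ 0 x = 0 ∧ fderiv ℝ (Function.extend Subtype.val ψ 0) x = 0)
    (T : ℝ) {t' : ℝ} (ht' : 0 ≤ t') (y : E3)
    (hne : Real.smoothTransition (T - t') *
            ∑ μ, KerrSchild.multiplierCurrent (inverseMetric M a) (fun (_ : E4) (ν : Fin 4) ↦ if ν = 0 then (1 : ℝ) else 0) (Function.extend Subtype.val ψ 0)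
              (E4.ofTimeSpace t' y) μ *
              fderiv ℝ (fun x : E4 ↦ radialTransition R' R' (E4.spatial x)) (E4.ofTimeSpace t' y)
                (E4.basisVector μ) -
          deriv Real.smoothTransition (T - t') *
            (radialTransition R' R' y *
              KerrSchild.multiplierCurrent (inverseMetric M a) (fun (_ : E4) (ν : Fin 4) ↦ if ν = 0 then (1 : ℝ) else 0) (Function.extend Subtype.val ψ 0)
                (E4.ofTimeSpace t' y) 0) ≠ 0 ∨
      Real.smoothTransition (T - t') *
        (48 * (∑ μ, |fderiv ℝ (fun z : E4 ↦ radialTransition R' R' (E4.spatial z)) (E4.ofTimeSpace t' y)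
            (E4.basisVector μ)|) *
          ∑ μ, fderiv ℝ (Function.extend Subtype.val ψ 0) (E4.ofTimeSpace t' y) (E4.basisVector μ) ^ 2) ≠ 0) :
    t' ≤ T ∧ ‖y‖ ≤ ρ₀ + T := by
  -- above the level `T` both `χ(T − t')` and `χ'(T − t')` vanish
  have hT : t' ≤ T := by
    by_contra hlt
    push Not at hlt
    have hz : Real.smoothTransition (T - t') = 0 := Real.smoothTransition.zero_of_nonpos (by linarith)
    have hz' : deriv Real.smoothTransition (T - t') = 0 := by
      have hev : Real.smoothTransition =ᶠ[𝓝 (T - t')] fun _ ↦ 0 := by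
        filter_upwards [(isOpen_gt' (0 : ℝ)).mem_nhds (show T - t' < 0 by linarith)] with σ hσ
        exact Real.smoothTransition.zero_of_nonpos (le_of_lt hσ)
      rw [hev.deriv_eq]
      simp
    rcases hne with h | h
    · exact h (by rw [hz, hz']; ring)
    · exact h (by rw [hz]; ring)
  refine ⟨hT, ?_⟩
  by_contra hfar
  push Not at hfar
  have h0 : 0 ≤ (E4.ofTimeSpace t' y) 0 := by rw [E4.ofTimeSpace_apply_zero]; exact ht'
  have hfar' : ρ₀ + (E4.ofTimeSpace t' y) 0 < E4.spatialNorm (E4.ofTimeSpace t' y) := by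
    rw [E4.ofTimeSpace_apply_zero, E4.spatialNorm_ofTimeSpace]; linarith
  have hd := (hρ₀ _ h0 hfar').2
  rcases hne with h | h
  · exact h (by simp [KerrSchild.multiplierCurrent_eq_zero_of_fderiv_eq_zero _ _ hd])
  · exact h (by simp [hd])

omit [Facts] [SliceFacts] in
/-- **Support of the space-time integrand, the collar majorant, and of their cut-off and plate parts**
(four-way form of `far_TCurrent_integrand_support`, same proof): under the same hypothesis
on `ψ̃`, if at a point `(t', y)` with `t' ≥ 0` the space-time integrand
`χ(T − t') ∑(J^T)^μ ∂_μ f − χ'(T − t') f (J^T)⁰` or the collar majorant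
`48 χ(T − t') (∑|∂_μ f|) ∑(∂_μψ̃)²` is nonzero, then `t' ≤ T` (above the level both `χ(T − t')` and
`χ'(T − t')` vanish) and `‖y‖ ≤ ρ₀ + T` (beyond, `dψ̃ = 0`). [folklore] -/
theorem far_TCurrent_integrand_support₄ {M a R' : ℝ} {ψ : region a (rPlus M a) → ℝ} {ρ₀ : ℝ}
    (hρ₀ : ∀ x : E4, 0 ≤ x 0 → ρ₀ + x 0 < E4.spatialNorm x →
      Function.extend Subtype.val ψ 0 x = 0 ∧ fderiv ℝ (Function.extend Subtype.val ψ 0) x = 0)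
    (T : ℝ) {t' : ℝ} (ht' : 0 ≤ t') (y : E3)
    (hne : Real.smoothTransition (T - t') *
            ∑ μ, KerrSchild.multiplierCurrent (inverseMetric M a) (fun (_ : E4) (ν : Fin 4) ↦ if ν = 0 then (1 : ℝ) else 0) (Function.extend Subtype.val ψ 0)
              (E4.ofTimeSpace t' y) μ *
              fderiv ℝ (fun x : E4 ↦ radialTransition R' R' (E4.spatial x)) (E4.ofTimeSpace t' y)
                (E4.basisVector μ) -
          deriv Real.smoothTransition (T - t') *
            (radialTransition R' R' y *
              KerrSchild.multiplierCurrent (inverseMetric M a) (fun (_ : E4) (ν : Fin 4) ↦ if ν = 0 then (1 : ℝ) else 0) (Function.extend Subtype.val ψ 0)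
                (E4.ofTimeSpace t' y) 0) ≠ 0 ∨
      Real.smoothTransition (T - t') *
        (48 * (∑ μ, |fderiv ℝ (fun z : E4 ↦ radialTransition R' R' (E4.spatial z)) (E4.ofTimeSpace t' y)
            (E4.basisVector μ)|) *
          ∑ μ, fderiv ℝ (Function.extend Subtype.val ψ 0) (E4.ofTimeSpace t' y) (E4.basisVector μ) ^ 2) ≠ 0 ∨
      Real.smoothTransition (T - t') *
            ∑ μ, KerrSchild.multiplierCurrent (inverseMetric M a) (fun (_ : E4) (ν : Fin 4) ↦ if ν = 0 then (1 : ℝ) else 0) (Function.extend Subtype.val ψ 0)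
              (E4.ofTimeSpace t' y) μ *
              fderiv ℝ (fun x : E4 ↦ radialTransition R' R' (E4.spatial x)) (E4.ofTimeSpace t' y)
                (E4.basisVector μ) ≠ 0 ∨
      deriv Real.smoothTransition (T - t') *
            (radialTransition R' R' y *
              KerrSchild.multiplierCurrent (inverseMetric M a) (fun (_ : E4) (ν : Fin 4) ↦ if ν = 0 then (1 : ℝ) else 0) (Function.extend Subtype.val ψ 0)
                (E4.ofTimeSpace t' y) 0) ≠ 0) :
    t' ≤ T ∧ ‖y‖ ≤ ρ₀ + T := by
  -- above the level `T` both `χ(T − t')` and `χ'(T − t')` vanish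
  have hT : t' ≤ T := by
    by_contra hlt
    push Not at hlt
    have hz : Real.smoothTransition (T - t') = 0 := Real.smoothTransition.zero_of_nonpos (by linarith)
    have hz' : deriv Real.smoothTransition (T - t') = 0 := by
      have hev : Real.smoothTransition =ᶠ[𝓝 (T - t')] fun _ ↦ 0 := by
        filter_upwards [(isOpen_gt' (0 : ℝ)).mem_nhds (show T - t' < 0 by linarith)] with σ hσ
        exact Real.smoothTransition.zero_of_nonpos (le_of_lt hσ)
      rw [hev.deriv_eq]
      simp
    rcases hne with h | h | h | h
    · exact h (by rw [hz, hz']; ring)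
    · exact h (by rw [hz]; ring)
    · exact h (by rw [hz]; ring)
    · exact h (by rw [hz']; ring)
  refine ⟨hT, ?_⟩
  by_contra hfar
  push Not at hfar
  have h0 : 0 ≤ (E4.ofTimeSpace t' y) 0 := by rw [E4.ofTimeSpace_apply_zero]; exact ht'
  have hfar' : ρ₀ + (E4.ofTimeSpace t' y) 0 < E4.spatialNorm (E4.ofTimeSpace t' y) := by
    rw [E4.ofTimeSpace_apply_zero, E4.spatialNorm_ofTimeSpace]; linarith
  have hd := (hρ₀ _ h0 hfar').2
  rcases hne with h | h | h | h
  · exact h (by simp [KerrSchild.multiplierCurrent_eq_zero_of_fderiv_eq_zero _ _ hd])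
  · exact h (by simp [hd])
  · exact h (by simp [KerrSchild.multiplierCurrent_eq_zero_of_fderiv_eq_zero _ _ hd])
  · exact h (by simp [KerrSchild.multiplierCurrent_eq_zero_of_fderiv_eq_zero _ _ hd])

/-! ### Comparability of the cut-off densities through a leaf with future timelike normal -/

/-- **The `T`- and `V`-energy densities through a graph leaf are comparable at the far points.** For
a height `F` whose leaf normals `W = −g♯d(t* − F)` are future-directed timelike on the exterior, at a
point `x` with `‖x⃗‖ ≥ R'` (`R' > R_af`, `R' ≥ 9M`): with `e_T = −∑(J^T)^μ n^F_μ`, `e_V = −∑(J^V)^μ n^F_μ`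
the coordinate densities of `ψ̃`, `0 ≤ e_T ≤ e_V ≤ 2 e_T` (`KerrLeafEnergyComparison.lean` through
`KerrSchildLeafCurrents.lean`). [cite: DafermosRodnianskiShlapentokhrothman2014, §3.1 and §3.3] -/
theorem far_leaf_comparison {M a R' : ℝ} (hMa : IsSubextremal M a)
    (hR'af : afRadius a (rPlus M a) < R') (hR'9 : 9 * M ≤ R') {ψ : region a (rPlus M a) → ℝ}
    (hψ : IsAdmissibleKerrWave M a ψ) {F : E3 → ℝ}
    (hW : ∀ x : region a (rPlus M a),
      ((timeOrientation M a (rPlus M a) hMa.pos.le).ofLE le_top :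
        TimeOrientation (smoothMetric M a (rPlus M a))).IsFutureDirected (x := x) (leafNormal M a F x) ∧
      (smoothMetric M a (rPlus M a)).IsTimelike (x := x) (leafNormal M a F x))
    {x : E4} (hx : R' ≤ E4.spatialNorm x) :
    x ∈ region a (rPlus M a) ∧
      0 ≤ -∑ μ, KerrSchild.multiplierCurrent (inverseMetric M a) (fun (_ : E4) (ν : Fin 4) ↦ if ν = 0 then (1 : ℝ) else 0) (Function.extend Subtype.val ψ 0) x μ *
          graphConormal F (E4.spatial x) μ ∧
      -∑ μ, KerrSchild.multiplierCurrent (inverseMetric M a) (fun (_ : E4) (ν : Fin 4) ↦ if ν = 0 then (1 : ℝ) else 0) (Function.extend Subtype.val ψ 0) x μ *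
          graphConormal F (E4.spatial x) μ ≤
        -∑ μ, KerrSchild.multiplierCurrent (inverseMetric M a) (fun (z : E4) (α : Fin 4) ↦ timeVector M a z α) (Function.extend Subtype.val ψ 0) x μ *
          graphConormal F (E4.spatial x) μ ∧
      -∑ μ, KerrSchild.multiplierCurrent (inverseMetric M a) (fun (z : E4) (α : Fin 4) ↦ timeVector M a z α) (Function.extend Subtype.val ψ 0) x μ *
          graphConormal F (E4.spatial x) μ ≤
        2 * -∑ μ, KerrSchild.multiplierCurrent (inverseMetric M a) (fun (_ : E4) (ν : Fin 4) ↦ if ν = 0 then (1 : ℝ) else 0) (Function.extend Subtype.val ψ 0) x μ *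
          graphConormal F (E4.spatial x) μ := by
  have hxaf : afRadius a (rPlus M a) < E4.spatialNorm x := hR'af.trans_le hx
  have hmem : x ∈ region a (rPlus M a) := mem_region_of_afRadius_lt_spatialNorm hxaf
  have hH : scalarH M a x ≤ 1 / 8 := scalarH_le_one_div_eight_of_le_spatialNorm hMa (hR'9.trans hx)
  have h2H : 2 * scalarH M a x < 1 := by linarith
  have hΦ : DifferentiableAt ℝ (Function.extend Subtype.val ψ 0) x :=
    differentiableAt_extend_of_mem hψ.1 hmem
  obtain ⟨hWf, hWt⟩ := hW ⟨x, hmem⟩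
  have h0 := stressEnergy_basisVector_zero_nonneg hMa.pos.le ⟨x, hmem⟩ h2H hWf hWt ψ
  have h1 := stressEnergy_basisVector_zero_le_timeVector hMa.pos ⟨x, hmem⟩ hWf hWt ψ
  have h2 := stressEnergy_timeVector_le_two_mul hMa.pos.le ⟨x, hmem⟩ hH hWf hWt ψ
  rw [stressEnergy_basisVector_zero_leafNormal_eq M a (extend_rep ψ) F ⟨x, hmem⟩ hΦ] at h0 h1 h2
  rw [stressEnergy_timeVector_leafNormal_eq M a (extend_rep ψ) F ⟨x, hmem⟩ hΦ] at h1 h2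
  exact ⟨hmem, h0, h1, h2⟩

omit [SliceFacts] in
/-- The leaf normals of `Σ̃_τ(h♯_{R₁})` are future-directed timelike on the exterior (`R₁ > 2M`).
[folklore] -/
theorem leafNormal_scriHeight_futureTimelike {M a R₁ : ℝ} (hMa : IsSubextremal M a)
    (hR₁ : 2 * M < R₁) (x : region a (rPlus M a)) :
    ((timeOrientation M a (rPlus M a) hMa.pos.le).ofLE le_top :
        TimeOrientation (smoothMetric M a (rPlus M a))).IsFutureDirected (x := x)
          (leafNormal M a (scriHeight M a R₁) x) ∧
      (smoothMetric M a (rPlus M a)).IsTimelike (x := x) (leafNormal M a (scriHeight M a R₁) x) :=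
  ⟨isFutureDirected_leafNormal_scriHeight hMa hR₁ x, isTimelike_leafNormal_scriHeight hMa hR₁ x⟩

omit [SliceFacts] in
/-- The normal `V` of the Kerr–Schild slices (the leaves of the zero height) is future-directed
timelike. [folklore] -/
theorem leafNormal_zero_futureTimelike {M a : ℝ} (hMa : IsSubextremal M a)
    (x : region a (rPlus M a)) :
    ((timeOrientation M a (rPlus M a) hMa.pos.le).ofLE le_top :
        TimeOrientation (smoothMetric M a (rPlus M a))).IsFutureDirected (x := x)
          (leafNormal M a (fun _ : E3 ↦ (0 : ℝ)) x) ∧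
      (smoothMetric M a (rPlus M a)).IsTimelike (x := x) (leafNormal M a (fun _ : E3 ↦ (0 : ℝ)) x) := by
  rw [leafNormal_eq_timeVector x (by simp)]
  exact ⟨(isFutureDirected_timeVector hMa.pos.le x).2, (isFutureDirected_timeVector hMa.pos.le x).1⟩

/-! ### The far-region `∂_{t*}`-energy inequality -/

/-- **The far-region energy inequality from a lower graph to a hyperboloidal leaf of subextremal
Kerr, together with the bound for the smeared plate energy** (Moschidis, arXiv:1509.08489, Lemma 4.5
(both terms of its left-hand side: the energy through `𝓢_{τ₂}` and through the plate `{t = T*}`), for the exact Killing field `T = ∂_{t*}` of Kerr; the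
far-region energy estimate (eq:1) of Dafermos–Rodnianski, arXiv:0910.4957, §3). Let `|a| < M`,
`R₁ > 2M`, `R'` a cut-off radius with `R_af < R'`, `9M ≤ R'`, `2R' < R₁`, `K` a bound for `|χ'|`
(`χ = Real.smoothTransition`), `ψ` an admissible wave, `0 ≤ s ≤ t`, and `F₁` a `C²` height with
`0 ≤ F₁ ≤ h♯_{R₁}` whose leaf normals are future-directed timelike (the leaf `Σ̃_s(h♯_{R₁})`:
`F₁ = h♯_{R₁}`; the slice `{t* = s}`: `F₁ = 0`). Then the `V`-flux through the far part
`{‖y‖ > 2R'}` of the leaf `Σ̃_t(h♯_{R₁})` is bounded by the `V`-flux through the lower graph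
`{t* = s + F₁}` and the local energy between the two on the collar `{‖y‖ ≤ 2R'}` (where both are
slices):
`farLeafFlux h♯ (t, 2R') ≤ 2 · leafFlux F₁ (s) + (1536 K / R') ∫_{[s,t]} localLeafFlux h♯ (τ, 2R') dτ`.
[cite: Moschidis2016, Lemma 4.5] -/
theorem farLeafFlux_and_plateEnergy_le {M a R₁ R' K : ℝ} (hMa : IsSubextremal M a)
    (hR₁ : 2 * M < R₁) (hR'af : afRadius a (rPlus M a) < R') (hR'9 : 9 * M ≤ R')
    (hR'R₁ : 2 * R' < R₁) (hK : ∀ σ, |deriv Real.smoothTransition σ| ≤ K)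
    {ψ : region a (rPlus M a) → ℝ} (hψ : IsAdmissibleKerrWave M a ψ)
    {F₁ : E3 → ℝ} (hF₁ : ContDiff ℝ 2 F₁) (hF₁0 : ∀ y, 0 ≤ F₁ y)
    (hF₁h : ∀ y, F₁ y ≤ scriHeight M a R₁ y)
    (hW₁ : ∀ x : region a (rPlus M a),
      ((timeOrientation M a (rPlus M a) hMa.pos.le).ofLE le_top :
        TimeOrientation (smoothMetric M a (rPlus M a))).IsFutureDirected (x := x) (leafNormal M a F₁ x) ∧
      (smoothMetric M a (rPlus M a)).IsTimelike (x := x) (leafNormal M a F₁ x))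
    {s t : ℝ} (hs : 0 ≤ s) (hst : s ≤ t) :
    (∀ T : ℝ, ENNReal.ofReal (∫ y, ∫ t' in Set.Ioc (s + F₁ y) (t + scriHeight M a R₁ y),
        deriv Real.smoothTransition (T - t') * (radialTransition R' R' y *
          -KerrSchild.multiplierCurrent (inverseMetric M a) (fun (_ : E4) (ν : Fin 4) ↦ if ν = 0 then (1 : ℝ) else 0) (Function.extend Subtype.val ψ 0)
            (E4.ofTimeSpace t' y) 0)) ≤
      leafFlux M a F₁ ψ s +
        ENNReal.ofReal (768 * K / R') *
          ∫⁻ τ in Set.Icc s t, ∫⁻ y in {y : E3 | R' ≤ ‖y‖ ∧ ‖y‖ ≤ 2 * R'}, leafFluxDensity M a (scriHeight M a R₁) ψ τ y) ∧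
    farLeafFlux M a (scriHeight M a R₁) ψ t (2 * R') ≤
      2 * leafFlux M a F₁ ψ s +
        ENNReal.ofReal (1536 * K / R') *
          ∫⁻ τ in Set.Icc s t, ∫⁻ y in {y : E3 | R' ≤ ‖y‖ ∧ ‖y‖ ≤ 2 * R'}, leafFluxDensity M a (scriHeight M a R₁) ψ τ y := by
  have hM : 0 < M := hMa.pos
  have hR' : 0 < R' := (afRadius_pos a (rPlus M a)).trans hR'af
  have hRp : rPlus M a < R₁ := (rPlus_le_two_mul hM.le).trans_lt hR₁
  have hR₁0 : 0 ≤ R₁ := by linarith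
  have hK0 : 0 ≤ K := (abs_nonneg _).trans (hK 0)
  obtain ⟨ρ₀, -, hρ₀⟩ := hψ.exists_extend_eq_zero_of_lt hMa
  have hAm : MeasurableSet {y : E3 | R' ≤ ‖y‖ ∧ ‖y‖ ≤ 2 * R'} :=
    (measurableSet_le measurable_const continuous_norm.measurable).inter
      (measurableSet_le continuous_norm.measurable measurable_const)
  -- notation
  set h : E3 → ℝ := scriHeight M a R₁ with hh
  have hF : ContDiff ℝ 2 h := hMa.contDiff_scriHeight hRp
  have hF1 : ContDiff ℝ 1 h := hMa.contDiff_scriHeight hRp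
  have hF₁1 : ContDiff ℝ 1 F₁ := hF₁.of_le one_le_two
  have hh0 : ∀ y, 0 ≤ h y := fun y ↦ scriHeight_nonneg hMa hRp y
  have hhc : Continuous h := hF.continuous
  have hF₁c : Continuous F₁ := hF₁.continuous
  have hXT : ∀ z : E4, afRadius a (rPlus M a) < E4.spatialNorm z → ∀ α,
      ContDiffAt ℝ 1 (fun y ↦ (fun (_ : E4) (ν : Fin 4) ↦ if ν = 0 then (1 : ℝ) else 0) y α) z := fun _ _ _ ↦ contDiffAt_const
  have hXV : ∀ z : E4, afRadius a (rPlus M a) < E4.spatialNorm z → ∀ α,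
      ContDiffAt ℝ 1 (fun y ↦ timeVector M a y α) z := fun z hz α ↦
    contDiffAt_timeVector_apply M a (radius_pos_of_mem_region (mem_region_of_afRadius_lt_spatialNorm hz)) α
  have hWh := leafNormal_scriHeight_futureTimelike hMa hR₁
  -- the cut-off `T`- and `V`-energy densities through the two graphs
  set eT : E4 → ℝ := fun x ↦ radialTransition R' R' (E4.spatial x) *
    -∑ μ, KerrSchild.multiplierCurrent (inverseMetric M a) (fun (_ : E4) (ν : Fin 4) ↦ if ν = 0 then (1 : ℝ) else 0) (Function.extend Subtype.val ψ 0) x μ *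
      graphConormal h (E4.spatial x) μ with heT
  set eV : E4 → ℝ := fun x ↦ radialTransition R' R' (E4.spatial x) *
    -∑ μ, KerrSchild.multiplierCurrent (inverseMetric M a) (fun (z : E4) (α : Fin 4) ↦ timeVector M a z α) (Function.extend Subtype.val ψ 0) x μ *
      graphConormal h (E4.spatial x) μ with heV
  set eT₁ : E4 → ℝ := fun x ↦ radialTransition R' R' (E4.spatial x) *
    -∑ μ, KerrSchild.multiplierCurrent (inverseMetric M a) (fun (_ : E4) (ν : Fin 4) ↦ if ν = 0 then (1 : ℝ) else 0) (Function.extend Subtype.val ψ 0) x μ *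
      graphConormal F₁ (E4.spatial x) μ with heT₁
  have heTc : Continuous eT := hψ.continuous_far_leafDensity hR'af hXT hF1
  have heVc : Continuous eV := hψ.continuous_far_leafDensity hR'af hXV hF1
  have heT₁c : Continuous eT₁ := hψ.continuous_far_leafDensity hR'af hXT hF₁1
  -- pointwise facts through the top leaf
  have hpt : ∀ x : E4, 0 ≤ eT x ∧ eT x ≤ eV x ∧ eV x ≤ 2 * eT x ∧
      (radialTransition R' R' (E4.spatial x) ≠ 0 → x ∈ region a (rPlus M a)) := by
    intro x
    by_cases hx : x ∈ tsupport fun z : E4 ↦ radialTransition R' R' (E4.spatial z)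
    · have hxR : R' ≤ E4.spatialNorm x := tsupport_radialTransition_comp_spatial_subset hR' hx
      obtain ⟨hmem, h1, h2, h3⟩ := far_leaf_comparison hMa hR'af hR'9 hψ hWh hxR
      have hf0 : 0 ≤ radialTransition R' R' (E4.spatial x) := radialTransition_nonneg _ _ _
      refine ⟨?_, ?_, ?_, fun _ ↦ hmem⟩
      · exact mul_nonneg hf0 h1
      · exact mul_le_mul_of_nonneg_left h2 hf0
      · simp only [heT, heV]; nlinarith [h3, hf0]
    · have hfx : (fun z : E4 ↦ radialTransition R' R' (E4.spatial z)) x = 0 :=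
        image_eq_zero_of_notMem_tsupport (f := fun z : E4 ↦ radialTransition R' R' (E4.spatial z)) hx
      simp only at hfx
      simp [heT, heV, hfx]
  -- pointwise facts through the bottom graph
  have hpt₁ : ∀ x : E4, 0 ≤ eT₁ x ∧
      (radialTransition R' R' (E4.spatial x) ≠ 0 → x ∈ region a (rPlus M a) ∧ eT₁ x ≤
        -∑ μ, KerrSchild.multiplierCurrent (inverseMetric M a) (fun (z : E4) (α : Fin 4) ↦ timeVector M a z α) (Function.extend Subtype.val ψ 0) x μ *
          graphConormal F₁ (E4.spatial x) μ) := by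
    intro x
    by_cases hx : x ∈ tsupport fun z : E4 ↦ radialTransition R' R' (E4.spatial z)
    · have hxR : R' ≤ E4.spatialNorm x := tsupport_radialTransition_comp_spatial_subset hR' hx
      obtain ⟨hmem, h1, h2, -⟩ := far_leaf_comparison hMa hR'af hR'9 hψ hW₁ hxR
      have hf0 : 0 ≤ radialTransition R' R' (E4.spatial x) := radialTransition_nonneg _ _ _
      have hf1 : radialTransition R' R' (E4.spatial x) ≤ 1 := radialTransition_le_one _ _ _
      refine ⟨mul_nonneg hf0 h1, fun _ ↦ ⟨hmem, ?_⟩⟩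
      simp only [heT₁]
      nlinarith [h1, h2, hf0, hf1]
    · have hfx : (fun z : E4 ↦ radialTransition R' R' (E4.spatial z)) x = 0 :=
        image_eq_zero_of_notMem_tsupport (f := fun z : E4 ↦ radialTransition R' R' (E4.spatial z)) hx
      simp only at hfx
      simp [heT₁, hfx]
  -- `g`: half the cut-off `V`-density through `Σ̃_t`, as a function of `y`
  set g : E3 → ℝ≥0∞ := fun y ↦ ENNReal.ofReal (eV (E4.ofTimeSpace (t + h y) y) / 2) with hg
  have hgm : Measurable g := by
    refine ENNReal.measurable_ofReal.comp ?_
    exact ((heVc.comp (E4.continuous_ofTimeSpace'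
      (continuous_const.add hhc) continuous_id)).div_const 2).measurable
  -- ### Step 1: the inequality at a fixed time level `T`
  have hstep : ∀ T : ℝ,
      (∫⁻ y, ENNReal.ofReal (Real.smoothTransition (T - (t + h y))) * g y) +
        ENNReal.ofReal (∫ y, ∫ t' in Set.Ioc (s + F₁ y) (t + h y),
          deriv Real.smoothTransition (T - t') * (radialTransition R' R' y *
            -KerrSchild.multiplierCurrent (inverseMetric M a) (fun (_ : E4) (ν : Fin 4) ↦ if ν = 0 then (1 : ℝ) else 0) (Function.extend Subtype.val ψ 0)
              (E4.ofTimeSpace t' y) 0)) ≤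
        leafFlux M a F₁ ψ s + ENNReal.ofReal (768 * K / R') *
          ∫⁻ τ in Set.Icc s t, ∫⁻ y in {y : E3 | R' ≤ ‖y‖ ∧ ‖y‖ ≤ 2 * R'}, leafFluxDensity M a h ψ τ y := by
    intro T
    -- the identity
    have hid := far_TCurrent_identity hMa hR₁ hR'af hψ hρ₀ hF₁ hF₁0 hF₁h hs hst T
    -- the two integrands and their properties
    set D : ℝ → E3 → ℝ := fun t' y ↦ Real.smoothTransition (T - t') *
        ∑ μ, KerrSchild.multiplierCurrent (inverseMetric M a) (fun (_ : E4) (ν : Fin 4) ↦ if ν = 0 then (1 : ℝ) else 0) (Function.extend Subtype.val ψ 0)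
          (E4.ofTimeSpace t' y) μ *
          fderiv ℝ (fun x : E4 ↦ radialTransition R' R' (E4.spatial x)) (E4.ofTimeSpace t' y)
            (E4.basisVector μ) -
      deriv Real.smoothTransition (T - t') * (radialTransition R' R' y *
        KerrSchild.multiplierCurrent (inverseMetric M a) (fun (_ : E4) (ν : Fin 4) ↦ if ν = 0 then (1 : ℝ) else 0) (Function.extend Subtype.val ψ 0)
          (E4.ofTimeSpace t' y) 0) with hD
    set m : ℝ → E3 → ℝ := fun t' y ↦ Real.smoothTransition (T - t') *
      (48 * (∑ μ, |fderiv ℝ (fun z : E4 ↦ radialTransition R' R' (E4.spatial z)) (E4.ofTimeSpace t' y)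
          (E4.basisVector μ)|) *
        ∑ μ, fderiv ℝ (Function.extend Subtype.val ψ 0) (E4.ofTimeSpace t' y) (E4.basisVector μ) ^ 2)
      with hm
    have hDc : Continuous (Function.uncurry D) := by
      have := (continuous_far_TCurrent_integrand hR'af hψ T).comp E4.continuous_ofTimeSpace_uncurry
      refine this.congr fun p ↦ ?_
      simp [hD, Function.uncurry]
    have hmc : Continuous (Function.uncurry m) := by
      have := (continuous_far_collar_majorant hR'af hψ T).comp E4.continuous_ofTimeSpace_uncurry
      refine this.congr fun p ↦ ?_
      simp [hm, Function.uncurry]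
    have hnegmc : Continuous (Function.uncurry fun t' y ↦ -m t' y) := hmc.neg
    -- the plate part `P = χ' f (J^T)⁰` (so that `D = D₁ − P`) and the cut-off part `D₁`
    set P : ℝ → E3 → ℝ := fun t' y ↦ deriv Real.smoothTransition (T - t') * (radialTransition R' R' y *
        KerrSchild.multiplierCurrent (inverseMetric M a) (fun (_ : E4) (ν : Fin 4) ↦ if ν = 0 then (1 : ℝ) else 0) (Function.extend Subtype.val ψ 0)
          (E4.ofTimeSpace t' y) 0) with hP
    set D₁ : ℝ → E3 → ℝ := fun t' y ↦ Real.smoothTransition (T - t') *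
        ∑ μ, KerrSchild.multiplierCurrent (inverseMetric M a) (fun (_ : E4) (ν : Fin 4) ↦ if ν = 0 then (1 : ℝ) else 0) (Function.extend Subtype.val ψ 0)
          (E4.ofTimeSpace t' y) μ *
          fderiv ℝ (fun x : E4 ↦ radialTransition R' R' (E4.spatial x)) (E4.ofTimeSpace t' y)
            (E4.basisVector μ) with hD₁
    have hDsplit : ∀ t' y, D t' y = D₁ t' y - P t' y := fun t' y ↦ rfl
    have hPc : Continuous (Function.uncurry P) := by
      have := (continuous_far_plate_integrand hR'af hψ T).comp E4.continuous_ofTimeSpace_uncurry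
      refine this.congr fun p ↦ ?_
      simp [hP, Function.uncurry]
    have hD₁c : Continuous (Function.uncurry D₁) := by
      have : Function.uncurry D₁ = fun p ↦ Function.uncurry D p + Function.uncurry P p := by
        funext p; simp [hDsplit, Function.uncurry]
      rw [this]; exact hDc.add hPc
    have ha : Continuous fun y ↦ s + F₁ y := continuous_const.add hF₁c
    have hb : Continuous fun y ↦ t + h y := continuous_const.add hhc
    have hsuppD : ∀ t' y, s + F₁ y < t' → t' ≤ t + h y → D t' y ≠ 0 →
        t' ∈ Set.Icc 0 T ∧ ‖y‖ ≤ ρ₀ + T := by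
      intro t' y h1 _ hne
      have ht'0 : 0 ≤ t' := by linarith [hF₁0 y]
      obtain ⟨hT, hy⟩ := far_TCurrent_integrand_support hρ₀ T ht'0 y (Or.inl hne)
      exact ⟨⟨ht'0, hT⟩, hy⟩
    have hsuppm : ∀ t' y, s + F₁ y < t' → t' ≤ t + h y → -m t' y ≠ 0 →
        t' ∈ Set.Icc 0 T ∧ ‖y‖ ≤ ρ₀ + T := by
      intro t' y h1 _ hne
      have ht'0 : 0 ≤ t' := by linarith [hF₁0 y]
      obtain ⟨hT, hy⟩ := far_TCurrent_integrand_support₄ hρ₀ T ht'0 y (Or.inr (Or.inl (neg_ne_zero.1 hne)))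
      exact ⟨⟨ht'0, hT⟩, hy⟩
    have hsuppm' : ∀ t' y, s + F₁ y < t' → t' ≤ t + h y → m t' y ≠ 0 →
        t' ∈ Set.Icc 0 T ∧ ‖y‖ ≤ ρ₀ + T := fun t' y h1 h2 hne ↦
      hsuppm t' y h1 h2 (neg_ne_zero.2 hne)
    have hsuppD₁ : ∀ t' y, s + F₁ y < t' → t' ≤ t + h y → D₁ t' y ≠ 0 →
        t' ∈ Set.Icc 0 T ∧ ‖y‖ ≤ ρ₀ + T := by
      intro t' y h1 _ hne
      have ht'0 : 0 ≤ t' := by linarith [hF₁0 y]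
      obtain ⟨hT, hy⟩ := far_TCurrent_integrand_support₄ hρ₀ T ht'0 y (Or.inr (Or.inr (Or.inl hne)))
      exact ⟨⟨ht'0, hT⟩, hy⟩
    have hsuppP : ∀ t' y, s + F₁ y < t' → t' ≤ t + h y → P t' y ≠ 0 →
        t' ∈ Set.Icc 0 T ∧ ‖y‖ ≤ ρ₀ + T := by
      intro t' y h1 _ hne
      have ht'0 : 0 ≤ t' := by linarith [hF₁0 y]
      obtain ⟨hT, hy⟩ := far_TCurrent_integrand_support₄ hρ₀ T ht'0 y (Or.inr (Or.inr (Or.inr hne)))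
      exact ⟨⟨ht'0, hT⟩, hy⟩
    have hnegPc : Continuous (Function.uncurry fun t' y ↦ -P t' y) := hPc.neg
    have hsuppnegP : ∀ t' y, s + F₁ y < t' → t' ≤ t + h y → -P t' y ≠ 0 →
        t' ∈ Set.Icc 0 T ∧ ‖y‖ ≤ ρ₀ + T := fun t' y h1 h2 hne ↦
      hsuppP t' y h1 h2 (neg_ne_zero.1 hne)
    have hle₁ : ∀ t' y, s + F₁ y < t' → t' ≤ t + h y → -m t' y ≤ D₁ t' y := fun t' y _ _ ↦
      far_TCurrent_cutoff_integrand_ge hMa hR₁ hR'af hR'9 hψ T (E4.ofTimeSpace t' y)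
    -- sign of the plate part: `−P ≥ 0`
    have hP0 : ∀ t' y, s + F₁ y < t' → t' ≤ t + h y → (fun _ _ ↦ (0 : ℝ)) t' y ≤ -P t' y := by
      intro t' y _ _
      simp only [hP]
      have hζ'0 : 0 ≤ deriv Real.smoothTransition (T - t') := Real.smoothTransition.monotone.deriv_nonneg
      have hf0 : 0 ≤ radialTransition R' R' y := radialTransition_nonneg _ _ _
      by_cases hfy : radialTransition R' R' y = 0
      · simp [hfy]
      · have hxR : R' ≤ E4.spatialNorm (E4.ofTimeSpace t' y) := by
          rw [E4.spatialNorm_ofTimeSpace]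
          by_contra hlt
          exact hfy (radialTransition_of_norm_le hR' (le_of_lt (not_le.1 hlt)))
        obtain ⟨-, -, -, -, -, hslice⟩ := far_point_package hMa hR₁ hR'af hR'9 hψ hxR
        nlinarith [mul_nonneg hζ'0 (mul_nonneg hf0 hslice)]
    -- `−∫∫ m ≤ ∫∫ D₁`, `0 ≤ ∫∫ (−P)`, and `∫∫ D = ∫∫ D₁ − ∫∫ P`
    have hint : ∫ y, ∫ t' in Set.Ioc (s + F₁ y) (t + h y), -m t' y ≤
        ∫ y, ∫ t' in Set.Ioc (s + F₁ y) (t + h y), D₁ t' y :=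
      E4.integral_integral_Ioc_mono hnegmc hD₁c ha hb hsuppm hsuppD₁ hle₁
    have hSnn : ∫ y, ∫ t' in Set.Ioc (s + F₁ y) (t + h y), (fun _ _ ↦ (0 : ℝ)) t' y ≤
        ∫ y, ∫ t' in Set.Ioc (s + F₁ y) (t + h y), -P t' y :=
      E4.integral_integral_Ioc_mono continuous_const hnegPc ha hb (fun _ _ _ _ h ↦ absurd rfl h)
        hsuppnegP hP0
    have hSnn' : 0 ≤ ∫ y, ∫ t' in Set.Ioc (s + F₁ y) (t + h y), -P t' y := by simpa using hSnn
    have hneg : ∫ y, ∫ t' in Set.Ioc (s + F₁ y) (t + h y), -m t' y =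
        -∫ y, ∫ t' in Set.Ioc (s + F₁ y) (t + h y), m t' y := by
      rw [← integral_neg]
      refine integral_congr_ae (Filter.Eventually.of_forall fun y ↦ ?_)
      exact integral_neg _
    have hsplit : ∫ y, ∫ t' in Set.Ioc (s + F₁ y) (t + h y), D t' y =
        (∫ y, ∫ t' in Set.Ioc (s + F₁ y) (t + h y), D₁ t' y) +
          ∫ y, ∫ t' in Set.Ioc (s + F₁ y) (t + h y), -P t' y := by
      rw [E4.integral_integral_Ioc_eq_integral_indicator hDc ha hb hsuppD,
        E4.integral_integral_Ioc_eq_integral_indicator hD₁c ha hb hsuppD₁,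
        E4.integral_integral_Ioc_eq_integral_indicator hnegPc ha hb hsuppnegP,
        ← integral_add (E4.integrable_indicator_wedge hD₁c ha hb hsuppD₁)
          (E4.integrable_indicator_wedge hnegPc ha hb hsuppnegP)]
      refine integral_congr_ae (Filter.Eventually.of_forall fun p ↦ ?_)
      by_cases hp : p ∈ {p : ℝ × E3 | s + F₁ p.2 < p.1 ∧ p.1 ≤ t + h p.2}
      · simp only [Set.indicator_of_mem hp, Function.uncurry, hDsplit]
        ring
      · simp only [Set.indicator_of_notMem hp, add_zero]
    -- the energies
    set Etop : ℝ := ∫ y, Real.smoothTransition (T - (t + h y)) * eT (E4.ofTimeSpace (t + h y) y)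
      with hEtop
    set Ebot : ℝ := ∫ y, Real.smoothTransition (T - (s + F₁ y)) * eT₁ (E4.ofTimeSpace (s + F₁ y) y)
      with hEbot
    set S : ℝ := ∫ y, ∫ t' in Set.Ioc (s + F₁ y) (t + h y), -P t' y with hS
    have hfluxtop : (∫ y, Real.smoothTransition (T - (t + h y)) *
        (radialTransition R' R' y *
          ∑ μ, KerrSchild.multiplierCurrent (inverseMetric M a) (fun (_ : E4) (ν : Fin 4) ↦ if ν = 0 then (1 : ℝ) else 0) (Function.extend Subtype.val ψ 0)
            (E4.ofTimeSpace (t + h y) y) μ * graphConormal h y μ)) = -Etop := by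
      rw [hEtop, ← integral_neg]
      refine integral_congr_ae (Filter.Eventually.of_forall fun y ↦ ?_)
      simp only [heT, E4.spatial_ofTimeSpace]
      ring
    have hfluxbot : (∫ y, Real.smoothTransition (T - (s + F₁ y)) *
        (radialTransition R' R' y *
          ∑ μ, KerrSchild.multiplierCurrent (inverseMetric M a) (fun (_ : E4) (ν : Fin 4) ↦ if ν = 0 then (1 : ℝ) else 0) (Function.extend Subtype.val ψ 0)
            (E4.ofTimeSpace (s + F₁ y) y) μ * graphConormal F₁ y μ)) = -Ebot := by
      rw [hEbot, ← integral_neg]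
      refine integral_congr_ae (Filter.Eventually.of_forall fun y ↦ ?_)
      simp only [heT₁, E4.spatial_ofTimeSpace]
      ring
    have hE : Etop + S ≤ Ebot + ∫ y, ∫ t' in Set.Ioc (s + F₁ y) (t + h y), m t' y := by
      have h1 : -Etop - -Ebot = ∫ y, ∫ t' in Set.Ioc (s + F₁ y) (t + h y), D t' y := by
        rw [← hfluxtop, ← hfluxbot]
        exact hid
      rw [hsplit] at h1
      linarith [hint, hneg, h1]
    -- the statement's plate integrand is `−P`
    have hSeq : (∫ y, ∫ t' in Set.Ioc (s + F₁ y) (t + h y),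
        deriv Real.smoothTransition (T - t') * (radialTransition R' R' y *
          -KerrSchild.multiplierCurrent (inverseMetric M a) (fun (_ : E4) (ν : Fin 4) ↦ if ν = 0 then (1 : ℝ) else 0) (Function.extend Subtype.val ψ 0)
            (E4.ofTimeSpace t' y) 0)) = S := by
      rw [hS]
      refine integral_congr_ae (Filter.Eventually.of_forall fun y ↦ ?_)
      refine setIntegral_congr_fun measurableSet_Ioc fun t' _ ↦ ?_
      simp only [hP]
      ring
    -- ### conversion to `[0, ∞]`
    -- integrability and sign of the leaf integrands
    have htopc : Continuous fun y ↦ Real.smoothTransition (T - (t + h y)) * eT (E4.ofTimeSpace (t + h y) y) :=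
      (Real.smoothTransition.continuous.comp (continuous_const.sub (continuous_const.add hhc))).mul
        (heTc.comp (E4.continuous_ofTimeSpace' (continuous_const.add hhc) continuous_id))
    have hbotc : Continuous fun y ↦ Real.smoothTransition (T - (s + F₁ y)) * eT₁ (E4.ofTimeSpace (s + F₁ y) y) :=
      (Real.smoothTransition.continuous.comp (continuous_const.sub (continuous_const.add hF₁c))).mul
        (heT₁c.comp (E4.continuous_ofTimeSpace' (continuous_const.add hF₁c) continuous_id))
    have htop0 : ∀ y, 0 ≤ Real.smoothTransition (T - (t + h y)) * eT (E4.ofTimeSpace (t + h y) y) :=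
      fun y ↦ mul_nonneg (Real.smoothTransition.nonneg _) (hpt _).1
    have hbot0 : ∀ y, 0 ≤ Real.smoothTransition (T - (s + F₁ y)) * eT₁ (E4.ofTimeSpace (s + F₁ y) y) :=
      fun y ↦ mul_nonneg (Real.smoothTransition.nonneg _) (hpt₁ _).1
    have htopsupp : HasCompactSupport fun y ↦
        Real.smoothTransition (T - (t + h y)) * eT (E4.ofTimeSpace (t + h y) y) := by
      refine HasCompactSupport.intro (isCompact_closedBall (0 : E3) (ρ₀ + T)) fun y hy ↦ ?_
      rw [mem_closedBall, dist_zero_right, not_le] at hy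
      have h0 := far_leafIntegrand_eq_zero (R' := R') hρ₀ (fun (_ : E4) (ν : Fin 4) ↦ if ν = 0 then (1 : ℝ) else 0) hh0 (τ := t) (T := T) (hs.trans hst) hy
      simp only [heT, E4.spatial_ofTimeSpace]
      have : Real.smoothTransition (T - (t + h y)) * (radialTransition R' R' y *
          ∑ μ, KerrSchild.multiplierCurrent (inverseMetric M a) (fun (_ : E4) (ν : Fin 4) ↦ if ν = 0 then (1 : ℝ) else 0) (Function.extend Subtype.val ψ 0)
            (E4.ofTimeSpace (t + h y) y) μ * graphConormal h y μ) = 0 := h0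
      linear_combination (-1 : ℝ) * this
    have hbotsupp : HasCompactSupport fun y ↦
        Real.smoothTransition (T - (s + F₁ y)) * eT₁ (E4.ofTimeSpace (s + F₁ y) y) := by
      refine HasCompactSupport.intro (isCompact_closedBall (0 : E3) (ρ₀ + T)) fun y hy ↦ ?_
      rw [mem_closedBall, dist_zero_right, not_le] at hy
      have h0 := far_leafIntegrand_eq_zero (R' := R') hρ₀ (fun (_ : E4) (ν : Fin 4) ↦ if ν = 0 then (1 : ℝ) else 0) hF₁0 (τ := s) (T := T) hs hy
      simp only [heT₁, E4.spatial_ofTimeSpace]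
      have : Real.smoothTransition (T - (s + F₁ y)) * (radialTransition R' R' y *
          ∑ μ, KerrSchild.multiplierCurrent (inverseMetric M a) (fun (_ : E4) (ν : Fin 4) ↦ if ν = 0 then (1 : ℝ) else 0) (Function.extend Subtype.val ψ 0)
            (E4.ofTimeSpace (s + F₁ y) y) μ * graphConormal F₁ y μ) = 0 := h0
      linear_combination (-1 : ℝ) * this
    have htopint : Integrable fun y ↦
        Real.smoothTransition (T - (t + h y)) * eT (E4.ofTimeSpace (t + h y) y) :=
      htopc.integrable_of_hasCompactSupport htopsupp
    have hbotint : Integrable fun y ↦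
        Real.smoothTransition (T - (s + F₁ y)) * eT₁ (E4.ofTimeSpace (s + F₁ y) y) :=
      hbotc.integrable_of_hasCompactSupport hbotsupp
    -- (i) the bottom energy is at most the flux through the lower graph
    have hbot : ENNReal.ofReal Ebot ≤ leafFlux M a F₁ ψ s := by
      rw [hEbot, ofReal_integral_eq_lintegral_ofReal hbotint (Filter.Eventually.of_forall hbot0)]
      refine lintegral_mono fun y ↦ ?_
      by_cases hfy : radialTransition R' R' y = 0
      · simp [heT₁, hfy]
      · obtain ⟨hmem, hle₁⟩ := (hpt₁ (E4.ofTimeSpace (s + F₁ y) y)).2 (by simpa using hfy)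
        rw [leafFluxDensity_eq_ofReal_extend M a hψ.1 F₁ s (by exact hmem)]
        refine ENNReal.ofReal_le_ofReal ?_
        have hζ1 : Real.smoothTransition (T - (s + F₁ y)) ≤ 1 := Real.smoothTransition.le_one _
        have hζ0 : 0 ≤ Real.smoothTransition (T - (s + F₁ y)) := Real.smoothTransition.nonneg _
        have h1 := (hpt₁ (E4.ofTimeSpace (s + F₁ y) y)).1
        have hle₁' : eT₁ (E4.ofTimeSpace (s + F₁ y) y) ≤
            -∑ μ, KerrSchild.multiplierCurrent (inverseMetric M a) (fun (z : E4) (α : Fin 4) ↦ timeVector M a z α) (Function.extend Subtype.val ψ 0)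
              (leafPoint F₁ s y) μ * graphConormal F₁ y μ := by
          simpa [leafPoint] using hle₁
        calc Real.smoothTransition (T - (s + F₁ y)) * eT₁ (E4.ofTimeSpace (s + F₁ y) y)
            ≤ 1 * eT₁ (E4.ofTimeSpace (s + F₁ y) y) := by gcongr
          _ ≤ _ := by rw [one_mul]; exact hle₁'
    -- (ii) the cut-off half `V`-density through `Σ̃_t` is at most the top energy
    have htop : ∫⁻ y, ENNReal.ofReal (Real.smoothTransition (T - (t + h y))) * g y ≤
        ENNReal.ofReal Etop := by
      rw [hEtop, ofReal_integral_eq_lintegral_ofReal htopint (Filter.Eventually.of_forall htop0)]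
      refine lintegral_mono fun y ↦ ?_
      rw [hg, ← ENNReal.ofReal_mul (Real.smoothTransition.nonneg _)]
      refine ENNReal.ofReal_le_ofReal ?_
      obtain ⟨-, -, h3, -⟩ := hpt (E4.ofTimeSpace (t + h y) y)
      have hζ0 : 0 ≤ Real.smoothTransition (T - (t + h y)) := Real.smoothTransition.nonneg _
      nlinarith [h3, hζ0]
    -- (iii) the collar term is a local energy
    have hcollar : ENNReal.ofReal (∫ y, ∫ t' in Set.Ioc (s + F₁ y) (t + h y), m t' y) ≤
        ENNReal.ofReal (768 * K / R') * ∫⁻ τ in Set.Icc s t, ∫⁻ y in {y : E3 | R' ≤ ‖y‖ ∧ ‖y‖ ≤ 2 * R'}, leafFluxDensity M a h ψ τ y := by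
      have hm0 : ∀ t' y, s + F₁ y < t' → t' ≤ t + h y → 0 ≤ m t' y := fun t' y _ _ ↦
        mul_nonneg (Real.smoothTransition.nonneg _) (mul_nonneg
          (mul_nonneg (by norm_num) (Finset.sum_nonneg fun μ _ ↦ abs_nonneg _))
          (Finset.sum_nonneg fun μ _ ↦ sq_nonneg _))
      rw [E4.ofReal_integral_integral_Ioc_eq_lintegral hmc ha hb hsuppm' hm0]
      -- pointwise bound of the truncated integrand
      have hpw : ∀ (t' : ℝ) (y : E3),
          {p : ℝ × E3 | s + F₁ p.2 < p.1 ∧ p.1 ≤ t + h p.2}.indicator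
              (fun p ↦ ENNReal.ofReal (Function.uncurry m p)) (t', y) ≤
            (Set.Ioc s t).indicator (fun τ ↦ ENNReal.ofReal (768 * K / R') *
              ({y : E3 | R' ≤ ‖y‖ ∧ ‖y‖ ≤ 2 * R'}).indicator (fun z ↦ leafFluxDensity M a h ψ τ z) y) t' := by
        intro t' y
        by_cases hp : (t', y) ∈ {p : ℝ × E3 | s + F₁ p.2 < p.1 ∧ p.1 ≤ t + h p.2}
        · rw [Set.indicator_of_mem hp]
          simp only [Function.uncurry_apply_pair]
          by_cases hmt : m t' y = 0
          · rw [hmt, ENNReal.ofReal_zero]; exact zero_le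
          · -- the derivative of the cut-off is nonzero: the point is in the collar
            have hcollar_pt : R' ≤ ‖y‖ ∧ ‖y‖ ≤ 2 * R' := by
              by_contra hc
              have hc' : E4.spatialNorm (E4.ofTimeSpace t' y) < R' ∨
                  2 * R' < E4.spatialNorm (E4.ofTimeSpace t' y) := by
                rw [E4.spatialNorm_ofTimeSpace]
                rcases not_and_or.1 hc with h1 | h1
                · exact Or.inl (not_le.1 h1)
                · exact Or.inr (not_le.1 h1)
              have hz : ∀ μ, fderiv ℝ (fun z : E4 ↦ radialTransition R' R' (E4.spatial z))
                  (E4.ofTimeSpace t' y) (E4.basisVector μ) = 0 :=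
                fderiv_radialTransition_comp_spatial_eq_zero hR' hc'
              exact hmt (by simp [hm, hz])
            have hy0 : h y = 0 := scriHeight_eq_zero_of_norm_le hR₁0 (by linarith [hcollar_pt.2])
            have hF₁y0 : F₁ y = 0 := le_antisymm (by simpa [hy0] using hF₁h y) (hF₁0 y)
            have ht'mem : t' ∈ Set.Ioc s t := by
              obtain ⟨hp1, hp2⟩ := hp
              simp only [hy0, hF₁y0, add_zero] at hp1 hp2
              exact ⟨hp1, hp2⟩
            have hymem : y ∈ {y : E3 | R' ≤ ‖y‖ ∧ ‖y‖ ≤ 2 * R'} := hcollar_pt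
            rw [Set.indicator_of_mem ht'mem, Set.indicator_of_mem hymem]
            -- the point is in the exterior and the leaf is the slice there
            have hxaf : afRadius a (rPlus M a) < E4.spatialNorm (E4.ofTimeSpace t' y) := by
              rw [E4.spatialNorm_ofTimeSpace]; linarith [hcollar_pt.1]
            have hmem : E4.ofTimeSpace t' y ∈ region a (rPlus M a) :=
              mem_region_of_afRadius_lt_spatialNorm hxaf
            rw [leafFluxDensity_scriHeight_of_norm_le hR₁0 hR'R₁ ψ t' hcollar_pt.2 hmem,
              ← ENNReal.ofReal_mul (by positivity)]
            refine ENNReal.ofReal_le_ofReal ?_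
            have hS := sum_sq_fderiv_extend_le_four_mul_stressEnergy hM.le ψ ⟨_, hmem⟩
            have hν : (∑ μ, |fderiv ℝ (fun z : E4 ↦ radialTransition R' R' (E4.spatial z))
                (E4.ofTimeSpace t' y) (E4.basisVector μ)|) ≤ 4 * (K / R') := by
              calc _ ≤ ∑ _μ : Fin 4, K / R' := Finset.sum_le_sum fun μ _ ↦
                    abs_fderiv_radialTransition_comp_spatial_le hR' hK _ μ
                _ = 4 * (K / R') := by simp
            have hζ1 : Real.smoothTransition (T - t') ≤ 1 := Real.smoothTransition.le_one _
            have hζ0 : 0 ≤ Real.smoothTransition (T - t') := Real.smoothTransition.nonneg _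
            have hν0 : 0 ≤ ∑ μ, |fderiv ℝ (fun z : E4 ↦ radialTransition R' R' (E4.spatial z))
                (E4.ofTimeSpace t' y) (E4.basisVector μ)| := Finset.sum_nonneg fun μ _ ↦ abs_nonneg _
            have hS0 : 0 ≤ ∑ μ, fderiv ℝ (Function.extend Subtype.val ψ 0) (E4.ofTimeSpace t' y)
                (E4.basisVector μ) ^ 2 := Finset.sum_nonneg fun μ _ ↦ sq_nonneg _
            have hKR : 0 ≤ K / R' := div_nonneg hK0 hR'.le
            simp only [hm]
            calc Real.smoothTransition (T - t') * (48 * (∑ μ, |fderiv ℝ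
                  (fun z : E4 ↦ radialTransition R' R' (E4.spatial z)) (E4.ofTimeSpace t' y)
                    (E4.basisVector μ)|) * ∑ μ, fderiv ℝ (Function.extend Subtype.val ψ 0)
                      (E4.ofTimeSpace t' y) (E4.basisVector μ) ^ 2)
                ≤ 1 * (48 * (4 * (K / R')) * (4 * (smoothMetric M a (rPlus M a)).stressEnergy ψ
                    ⟨_, hmem⟩ (timeVector M a (E4.ofTimeSpace t' y))
                      (timeVector M a (E4.ofTimeSpace t' y)))) := by
                  gcongr
              _ = 768 * K / R' * (smoothMetric M a (rPlus M a)).stressEnergy ψ ⟨_, hmem⟩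
                    (timeVector M a (E4.ofTimeSpace t' y)) (timeVector M a (E4.ofTimeSpace t' y)) := by
                  ring
        · rw [Set.indicator_of_notMem hp]; exact zero_le
      -- integrate the bound
      calc ∫⁻ t', ∫⁻ y, {p : ℝ × E3 | s + F₁ p.2 < p.1 ∧ p.1 ≤ t + h p.2}.indicator
              (fun p ↦ ENNReal.ofReal (Function.uncurry m p)) (t', y)
          ≤ ∫⁻ t', ∫⁻ y, (Set.Ioc s t).indicator (fun τ ↦ ENNReal.ofReal (768 * K / R') *
              ({y : E3 | R' ≤ ‖y‖ ∧ ‖y‖ ≤ 2 * R'}).indicator (fun z ↦ leafFluxDensity M a h ψ τ z) y) t' :=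
            lintegral_mono fun t' ↦ lintegral_mono fun y ↦ hpw t' y
        _ = ∫⁻ t' in Set.Ioc s t, ENNReal.ofReal (768 * K / R') * ∫⁻ y in {y : E3 | R' ≤ ‖y‖ ∧ ‖y‖ ≤ 2 * R'}, leafFluxDensity M a h ψ t' y := by
            rw [← lintegral_indicator measurableSet_Ioc]
            refine lintegral_congr fun t' ↦ ?_
            by_cases ht' : t' ∈ Set.Ioc s t
            · simp only [Set.indicator_of_mem ht']
              rw [lintegral_const_mul' _ _ ENNReal.ofReal_ne_top, lintegral_indicator hAm]
            · simp only [Set.indicator_of_notMem ht', lintegral_zero]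
        _ = ENNReal.ofReal (768 * K / R') * ∫⁻ τ in Set.Ioc s t, ∫⁻ y in {y : E3 | R' ≤ ‖y‖ ∧ ‖y‖ ≤ 2 * R'}, leafFluxDensity M a h ψ τ y := by
            rw [lintegral_const_mul' _ _ ENNReal.ofReal_ne_top]
        _ ≤ ENNReal.ofReal (768 * K / R') * ∫⁻ τ in Set.Icc s t, ∫⁻ y in {y : E3 | R' ≤ ‖y‖ ∧ ‖y‖ ≤ 2 * R'}, leafFluxDensity M a h ψ τ y := by
            gcongr
            exact Set.Ioc_subset_Icc_self
    -- (iv) combine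
    have hEtop0 : 0 ≤ Etop := integral_nonneg htop0
    rw [hSeq]
    calc (∫⁻ y, ENNReal.ofReal (Real.smoothTransition (T - (t + h y))) * g y) + ENNReal.ofReal S
        ≤ ENNReal.ofReal Etop + ENNReal.ofReal S := add_le_add htop le_rfl
      _ = ENNReal.ofReal (Etop + S) := (ENNReal.ofReal_add hEtop0 hSnn').symm
      _ ≤ ENNReal.ofReal (Ebot + ∫ y, ∫ t' in Set.Ioc (s + F₁ y) (t + h y), m t' y) :=
          ENNReal.ofReal_le_ofReal hE
      _ ≤ ENNReal.ofReal Ebot + ENNReal.ofReal (∫ y, ∫ t' in Set.Ioc (s + F₁ y) (t + h y), m t' y) :=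
          ENNReal.ofReal_add_le
      _ ≤ leafFlux M a F₁ ψ s + ENNReal.ofReal (768 * K / R') *
            ∫⁻ τ in Set.Icc s t, ∫⁻ y in {y : E3 | R' ≤ ‖y‖ ∧ ‖y‖ ≤ 2 * R'}, leafFluxDensity M a h ψ τ y :=
          add_le_add hbot hcollar
  -- ### Step 2: `T → ∞`
  have hlim : ∫⁻ y, g y ≤ leafFlux M a F₁ ψ s + ENNReal.ofReal (768 * K / R') *
      ∫⁻ τ in Set.Icc s t, ∫⁻ y in {y : E3 | R' ≤ ‖y‖ ∧ ‖y‖ ≤ 2 * R'}, leafFluxDensity M a h ψ τ y :=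
    E4.lintegral_le_of_forall_lintegral_timeCutoff_le Real.smoothTransition.monotone
      Real.smoothTransition.le_one (fun σ hσ ↦ Real.smoothTransition.one_of_one_le hσ)
      (continuous_const.add hhc).measurable hgm.aemeasurable (T₀ := 0) fun T _ ↦
        le_self_add.trans (hstep T)
  -- ### Step 3: the far flux is at most `2 ∫ g`
  have hfar : farLeafFlux M a h ψ t (2 * R') ≤ 2 * ∫⁻ y, g y := by
    calc farLeafFlux M a h ψ t (2 * R')
        = ∫⁻ y in (closedBall (0 : E3) (2 * R'))ᶜ, leafFluxDensity M a h ψ t y := rfl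
      _ = ∫⁻ y in (closedBall (0 : E3) (2 * R'))ᶜ, 2 * g y := by
          refine setLIntegral_congr_fun measurableSet_closedBall.compl fun y hy ↦ ?_
          rw [Set.mem_compl_iff, mem_closedBall, dist_zero_right, not_le] at hy
          have hf1 : radialTransition R' R' y = 1 := radialTransition_of_le_norm hR' (by linarith)
          have hxaf : afRadius a (rPlus M a) < E4.spatialNorm (E4.ofTimeSpace (t + h y) y) := by
            rw [E4.spatialNorm_ofTimeSpace]; linarith
          have hmem : leafPoint h t y ∈ region a (rPlus M a) := mem_region_of_afRadius_lt_spatialNorm hxaf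
          have key : (-∑ μ, KerrSchild.multiplierCurrent (inverseMetric M a)
              (fun (z : E4) (α : Fin 4) ↦ timeVector M a z α) (Function.extend Subtype.val ψ 0)
                (leafPoint h t y) μ * graphConormal h y μ) =
              2 * (eV (E4.ofTimeSpace (t + h y) y) / 2) := by
            simp only [heV, E4.spatial_ofTimeSpace, hf1, one_mul, leafPoint]
            ring
          rw [leafFluxDensity_eq_ofReal_extend M a hψ.1 h t hmem, key,
            ENNReal.ofReal_mul (by norm_num : (0 : ℝ) ≤ 2), ENNReal.ofReal_ofNat]
      _ ≤ ∫⁻ y, 2 * g y := setLIntegral_le_lintegral _ _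
      _ = 2 * ∫⁻ y, g y := lintegral_const_mul' _ _ (by norm_num)
  -- ### conclusion
  refine ⟨fun T ↦ le_add_self.trans (hstep T), ?_⟩
  calc farLeafFlux M a h ψ t (2 * R') ≤ 2 * ∫⁻ y, g y := hfar
    _ ≤ 2 * (leafFlux M a F₁ ψ s + ENNReal.ofReal (768 * K / R') *
          ∫⁻ τ in Set.Icc s t, ∫⁻ y in {y : E3 | R' ≤ ‖y‖ ∧ ‖y‖ ≤ 2 * R'}, leafFluxDensity M a h ψ τ y) := by
        gcongr
    _ = 2 * leafFlux M a F₁ ψ s + ENNReal.ofReal (1536 * K / R') *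
          ∫⁻ τ in Set.Icc s t, ∫⁻ y in {y : E3 | R' ≤ ‖y‖ ∧ ‖y‖ ≤ 2 * R'}, leafFluxDensity M a h ψ τ y := by
        have h2 : (2 : ℝ≥0∞) * ENNReal.ofReal (768 * K / R') = ENNReal.ofReal (1536 * K / R') := by
          rw [show (2 : ℝ≥0∞) = ENNReal.ofReal 2 by norm_num, ← ENNReal.ofReal_mul (by norm_num)]
          congr 1; ring
        rw [mul_add, ← mul_assoc, h2]

/-- **The far-region energy inequality from a lower graph to a leaf** (second component of
`farLeafFlux_and_plateEnergy_le`): `farLeafFlux h♯ (t, 2R') ≤ 2 · leafFlux F₁ (s) + (1536 K / R') · (annulus error)`.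
[cite: Moschidis2016, Lemma 4.5] -/
theorem farLeafFlux_scriHeight_le_leafFlux {M a R₁ R' K : ℝ} (hMa : IsSubextremal M a)
    (hR₁ : 2 * M < R₁) (hR'af : afRadius a (rPlus M a) < R') (hR'9 : 9 * M ≤ R')
    (hR'R₁ : 2 * R' < R₁) (hK : ∀ σ, |deriv Real.smoothTransition σ| ≤ K)
    {ψ : region a (rPlus M a) → ℝ} (hψ : IsAdmissibleKerrWave M a ψ)
    {F₁ : E3 → ℝ} (hF₁ : ContDiff ℝ 2 F₁) (hF₁0 : ∀ y, 0 ≤ F₁ y)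
    (hF₁h : ∀ y, F₁ y ≤ scriHeight M a R₁ y)
    (hW₁ : ∀ x : region a (rPlus M a),
      ((timeOrientation M a (rPlus M a) hMa.pos.le).ofLE le_top :
        TimeOrientation (smoothMetric M a (rPlus M a))).IsFutureDirected (x := x) (leafNormal M a F₁ x) ∧
      (smoothMetric M a (rPlus M a)).IsTimelike (x := x) (leafNormal M a F₁ x))
    {s t : ℝ} (hs : 0 ≤ s) (hst : s ≤ t) :
    farLeafFlux M a (scriHeight M a R₁) ψ t (2 * R') ≤
      2 * leafFlux M a F₁ ψ s +
        ENNReal.ofReal (1536 * K / R') *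
          ∫⁻ τ in Set.Icc s t, ∫⁻ y in {y : E3 | R' ≤ ‖y‖ ∧ ‖y‖ ≤ 2 * R'}, leafFluxDensity M a (scriHeight M a R₁) ψ τ y :=
  (farLeafFlux_and_plateEnergy_le hMa hR₁ hR'af hR'9 hR'R₁ hK hψ hF₁ hF₁0 hF₁h hW₁ hs hst).2

/-- **The far-region energy inequality between two leaves `Σ̃_s(h♯_{R₁})`, `Σ̃_t(h♯_{R₁})`**
(`F₁ = h♯_{R₁}` in `farLeafFlux_scriHeight_le_leafFlux`; Moschidis, arXiv:1509.08489, Lemma 4.5):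
`farLeafFlux(t, 2R') ≤ 2 · leafFlux(s) + (1536 K / R') ∫_{[s,t]} localLeafFlux(τ, 2R') dτ`, all
fluxes through the foliation `Σ̃_τ(h♯_{R₁})`, for admissible `ψ` and `0 ≤ s ≤ t` (the collar annulus
being enlarged to the ball, the currency of `Kerr.localError`).
[cite: Moschidis2016, Lemma 4.5] -/
theorem farLeafFlux_scriHeight_le {M a R₁ R' K : ℝ} (hMa : IsSubextremal M a) (hR₁ : 2 * M < R₁)
    (hR'af : afRadius a (rPlus M a) < R') (hR'9 : 9 * M ≤ R') (hR'R₁ : 2 * R' < R₁)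
    (hK : ∀ σ, |deriv Real.smoothTransition σ| ≤ K) {ψ : region a (rPlus M a) → ℝ}
    (hψ : IsAdmissibleKerrWave M a ψ) {s t : ℝ} (hs : 0 ≤ s) (hst : s ≤ t) :
    farLeafFlux M a (scriHeight M a R₁) ψ t (2 * R') ≤
      2 * leafFlux M a (scriHeight M a R₁) ψ s +
        ENNReal.ofReal (1536 * K / R') *
          ∫⁻ τ in Set.Icc s t, localLeafFlux M a (scriHeight M a R₁) ψ τ (2 * R') := by
  refine (farLeafFlux_scriHeight_le_leafFlux hMa hR₁ hR'af hR'9 hR'R₁ hK hψ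
    (hMa.contDiff_scriHeight ((rPlus_le_two_mul hMa.pos.le).trans_lt hR₁)) (fun y ↦
      scriHeight_nonneg hMa ((rPlus_le_two_mul hMa.pos.le).trans_lt hR₁) y) (fun _ ↦ le_rfl)
    (leafNormal_scriHeight_futureTimelike hMa hR₁) hs hst).trans ?_
  gcongr with τ
  exact lintegral_mono_set fun y hy ↦ by
    rw [mem_closedBall, dist_zero_right]; exact hy.2

/-- **The far-region energy inequality from the Kerr–Schild slice `{t* = s}` to the leaf
`Σ̃_t(h♯_{R₁})`** (`F₁ = 0` in `farLeafFlux_scriHeight_le_leafFlux`; the case `s = 0` initialises the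
far-region estimates from the slice carrying the compactly supported data):
`farLeafFlux h♯ (t, 2R') ≤ 2 · leafFlux 0 (s) + (1536 K / R') ∫_{[s,t]} ∫_{R' ≤ ‖y‖ ≤ 2R'} leafFluxDensity h♯ (τ, y) dy dτ`,
`leafFlux 0 (s)` the `V`-flux through the slice `{t* = s}` (`≤ 15 · sliceEnergy`,
`Kerr.leafFlux_zero_height_le_sliceEnergy`); the error is kept on the far annulus, where it is
finite for every admissible wave. [cite: Moschidis2016, Lemma 4.5] -/
theorem farLeafFlux_scriHeight_le_leafFlux_slice {M a R₁ R' K : ℝ} (hMa : IsSubextremal M a)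
    (hR₁ : 2 * M < R₁) (hR'af : afRadius a (rPlus M a) < R') (hR'9 : 9 * M ≤ R')
    (hR'R₁ : 2 * R' < R₁) (hK : ∀ σ, |deriv Real.smoothTransition σ| ≤ K)
    {ψ : region a (rPlus M a) → ℝ} (hψ : IsAdmissibleKerrWave M a ψ) {s t : ℝ} (hs : 0 ≤ s)
    (hst : s ≤ t) :
    farLeafFlux M a (scriHeight M a R₁) ψ t (2 * R') ≤
      2 * leafFlux M a (fun _ : E3 ↦ (0 : ℝ)) ψ s +
        ENNReal.ofReal (1536 * K / R') *
          ∫⁻ τ in Set.Icc s t, ∫⁻ y in {y : E3 | R' ≤ ‖y‖ ∧ ‖y‖ ≤ 2 * R'},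
            leafFluxDensity M a (scriHeight M a R₁) ψ τ y :=
  farLeafFlux_scriHeight_le_leafFlux hMa hR₁ hR'af hR'9 hR'R₁ hK hψ contDiff_const (fun _ ↦ le_rfl)
    (fun y ↦ scriHeight_nonneg hMa ((rPlus_le_two_mul hMa.pos.le).trans_lt hR₁) y)
    (leafNormal_zero_futureTimelike hMa) hs hst

end Kerr

end Literature.Geometry.Lorentzian
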